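import Mathlib
import Literature.Claims.NS.ClayVariants
import Literature.Analysis.FluidPDE.TaoLocalisation
import HarnessLib
import Literature.Analysis.FluidPDE.ClassicalSolutionTimeGluing

/-!
# Claim skeleton (D-0090 NS-CLAIMS, C06): P. Smith (2006), «Immortal Smooth Solution of the Three Space
# Dimensional Navier–Stokes System»

Cell `ns-claims`, claim C06, typist `ns-claims-typist-6` (refuter `ns-claims-refuter-3`, referee
`ns-claims-ref-2`). WITHDRAWN / DISPUTED CLAIM under adjudication — NOTHING in this file asserts a step of
the paper: every printed statement is a `def … : Prop`; the `theorem`s are kernel-checked RELATIONS between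
them (the paper's own two-line proofs, unfolding lemmas, the Clay link). Verdict vocabulary is the
refuter's/referee's; this file only fixes the locators.

Version of record: arXiv:math/0609740 **v4** (2006-10-05), 9 pp. [Smith2006] (v5, 2006-10-08: «This paper
is being withdrawn by the author due a serious flaw.»); TeX line numbers `l.N` refer to
`pub/ns-claims/sources/Smith2006/arxiv-math0609740/v4-2006-10-05-jupiter.tex`, pages to the arXiv v4 PDF
(ns-claims-lit-2, `sources/Smith2006/LOCATORS.md`). Upstream results the paper imports: [Sm3] =
arXiv:math/0605352 v4 [Smith2006PerronGeneral] (withdrawn the same day; its Thm 1 p. 2, Thm 4 p. 10, Thm 5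
p. 10, Thm 6 pp. 10–11, Defs 9–16 pp. 10–11, Remark p. 11 l. 1103–1106 were read); [Sm1]/[Sm2]/[Sm4] = J. Math.
Anal. Appl. 316 (2006) 357–368 / 483–494 / corrigendum — NOT held in citable form (acq-11590 / acq-11446 /
acq-11447): where the printed chain bottoms out in them this is said («proof imported, source wanted»).

## Claimed statement (as printed)

Abstract, p. 1: «We show the existence of an immortal smooth solution the three space dimensional
Navier-Stokes System, which gives a positive answer to Conjecture (A) page 2 of [F].» Theorem 8, p. 8
(l. 713–722): «Under the hypothesis of Theorem 1, with f = 0 there exists a C^∞ classical solution denoted by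
u,p of the Cauchy Problem, in [0,∞) × ℝ³, for the Navier-Stokes System: eqs (1), (2) with initial data u⁰
at t = 0. For this solution u,p ∈ C^∞([ ,∞) × ℝ³) and ∫_ℝ |u(t,x)| dx ≤ C ∀ t ≥ 0.»; p. 9 l. 779–781: «by
the transformation of eq (3) (4), we can replace υ = 1 by any positive υ»; Corollary 2, p. 9 (l. 785–789):
«Statement (A) page 2 of [F] is true. Proof: The hypothesis of the his statement are covered by the
hypothesis of Theorem 8.» Data class of Theorem 1 (p. 2, l. 88–89): «u⁰ ∈ H^{m,2}(ℝ³) ∩ C^∞(ℝ³) ∀ m ∈ Z⁺».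
Typed: `ClaimedTheorem := smithSpec.Regularity` — the (A)-shaped statement over the schema of
`Literature.Claims.NS.ClayVariants` with data slot «all derivatives in L²» (⊇ Clay (4)), force ≡ 0, side
condition (7); the printed «∫_ℝ |u| dx ≤ C» (an integral over ℝ of a field on ℝ³) is read as Clay (7)
(referee ns-claims-ref-2, RETYPE.md R#0; misprint level, axis Δ6).

## Clay delta (reference `ClayVariants.lean`)

Nearest: (A). `clay_of_claimed : ClaimedTheorem → ClayVariants.clayR3.Regularity` is PROVED below
(`Regularity.mono`: the data class contains (4) by `HasRapidSpatialDecay.lintegral_enorm_iteratedFDeriv_sq_lt_top`,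
the side condition is (7) verbatim), and summit-side `clayR3.Regularity ↔ NavierStokesRegularity` is
`Iff.rfl`. Axes: Δ1 domain ℝ³ = · Δ2 equations = (υ scaled to 1 by (3)–(4) p. 1, undone p. 9 l. 779–781; the
kernel uses `ClaySpec.regularityAt_iff_regularity`) · Δ3 force ≡ 0 = · Δ4 data H^∞ ∩ C^∞ ⊇ (4) (claim admits
MORE data) · Δ5 solution class C^∞ + (7) = · Δ6 conclusion global, misprinted energy integral read as (7) ·
Δ7 all υ. No «wrong problem» axis.

## Solution notion (typing fork, recorded)

The print works with P-VISCOSITY sub/super/solutions ([Sm3] Defs 9–16 pp. 10–11, built on [Sm1] Def 18 as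
modified by [Sm3] Remark p. 10 l. 868–875; the base definitions are not held in citable form). This file does
NOT type that notion. It enters as an explicit hypothesis-structure `PViscosityNotion` whose only fields are
the two facts the print states and USES about it: a C² ∩ bounded ∩ H^{2,2} field whose residual
`L_λ(V) − F` is `≥ 0` (`≤ 0`) componentwise is a supersolution (subsolution) — [Sm3] Remark p. 11
l. 1103–1106 («if u is C² at X then £⁻(u)(X) = £⁺(u)(X) = £u(X)»), v4 p. 9 l. 747–748 («a classical
solution—and hence a-fortiori a P-solution»), and v4 Thm 4 proof p. 4 l. 364–367 (the comparison principle is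
APPLIED to the C^{2+ε₀} ∩ H^{2,2} barriers of Thm 2). Consequences: every universally quantified step
(comparison, bounds, uniqueness) is typed WEAKER than printed — a classical kernel countermodel refutes the
print a fortiori, for every notion `vn` at once (`comparisonAuxClassical_of`); the existential step Thm 3 is
NOT overstated (it asserts a `vn`-solution, not a classical one); `claim_of_steps` holds for every `vn`.
Sign convention: SUPER = residual ≥ 0, SUB = residual ≤ 0 ([Sm3] Defs 11/12 with the Remark p. 11, and [Sm3]
Thm 1 p. 2 «L(u₁) ≥ 0, L(u₂) ≤ 0 ⇒ u₁ ≥ u₂»); [Sm3] Thm 4 p. 10 prints the opposite inequalities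
(«supersolution of L⁺(u₁) ≤ 0 … subsolution of L⁻ ≥ 0 … Then u₁ ≥ u₂») — typed as the `…Flipped` variants;
v4 Thm 4's USE is convention-free (the solution lies between the two barriers of Thm 2 in either order).

## Other typing forks (referee ns-claims-ref-2, INBOX 2026-08-26T16:59:59Z; lead F17)

* F₁ SLOT. Eq. (13) p. 3 / Definition 1 p. 2 put Heywood's PRESSURE `p` in the first slot of the right-hand
  side `F` («F_H := (p, f₁, f₂, f₃, 0,0,0)»), defined for `0 < t < T₀` only, while p. 2 l. 133–135 says the
  λ = 0 system «reduces to a first order system form of the Navier-Stokes System» and Thms 5–8 pose the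
  problem on `[T₀/2, ∞)`. With `F₁ = p` the λ = 0 `p`-row reads `div v = p` (`auxResidualP_zero_lam`): the
  limit of Thm 8 would not be divergence free, and `F_H` is undefined for `t ≥ T₀`. COMPOSITION is typed
  under the reading the text forces, `F₁ = 0` (with `f = 0`: `AuxForce.zero`); AS PRINTED the chain does not
  compose at Thm 8 p. 9 (LOGIC item, downstream of Thms 2–4).
* DATA. Eq. (14) p. 5 gives `Υ_H` 12 components; Remark 3 feeds it to Thm 3 as a 13-vector. Natural
  reconstruction: `p`-slot `:= p_H(T₀/2)` (`heywoodData`).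
* DATA/FORCE CLASSES narrowed to what the chain uses: data `C^∞ ∩ H^∞` (printed `C^{2+ε₀} ∩ H^{3,2}`),
  classical comparands `C²` (printed `C^{2+ε₀}`), force decay uniform in `t` (hypothesis side). Each
  narrowing makes the typed step WEAKER than the printed one.
* Thm 6 p. 7 DATA SENTENCE (l. 599–609: the `D_{he₀}` Cauchy problem has «initial data at t = T₀/2 given by
  the `D_{he₀}` difference quotient of … Υ_H(T₀/2)», and Thm 6: «W := D_{he₀}(V) is the unique solution of
  the D_{he₀} Cauchy problem») — read literally it identifies `V_λ(T₀/2 + h)` with `Υ_H(T₀/2 + h)`; read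
  charitably (backward quotient into Heywood's solution, «times between T₀/4 and 3T₀/4 … by design») it is a
  definition. Not typed as a conjunct; the load-bearing content of Thms 5–7 is the BOUNDS (typed), and the
  jet matching the limit needs appears where the print asserts it, in Thm 8's conclusion (l. 763–766).

## ORDERED STEP INDEX (dependency order, TYPING-HYGIENE §11; `claim_of_steps` takes them in this order)

* Step 1 = `Theorem1Heywood` (Thm 1 [Heywood], p. 2 l. 87–115; classical, [H] = Indiana Univ. Math. J. 29
  (1980) 639–681; tree: `tao2011_smooth_local_existence_holds` covers existence for `f = 0`).
* Step 2 = `Theorem2Barriers` (Thm 2 (1)–(4), pp. 3–4 l. 266–317, LITERAL (3): one barrier pair for all λ;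
  proof IMPORTED: «the same proofs as in Theorems 15, 20 of [Sm2]. See also the errata [Sm4]» — sources
  wanted acq-11446/11447); Step 2′ = `Theorem2Barriers'` (CHARITABLE (3): barriers may depend on λ, the
  bound M not — all the sequel consumes; `theorem2Barriers'_of_literal`); Step 2″ = `Theorem2BarriersHeywood`
  (the instance the chain consumes: t̂ = T₀/2, data Υ_H(T₀/2), F = 0 — initial layer compatible;
  `theorem2BarriersHeywood_of` from 2′ + Step 5).
* Step 3 = `Theorem3 vn` = `Theorem3Exists vn ∧ Theorem3Unique vn` (Thm 3, p. 4 l. 321–348; existence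
  imported from [Sm3] Thm 5 p. 10 ← [Sm2] Thm 1 (wanted); uniqueness = [Sm3] Thm 6 pp. 10–11, whose printed
  proof is the comparison principle: `theorem3Unique_of_comparison`).
* support = `Sm3Theorem4General` / `Sm3Theorem4GeneralFlipped` ([Sm3] Thm 4 p. 10 in printed generality,
  classical comparands) and its instance on system (6) `ComparisonAux vn` (notion level) /
  `ComparisonAuxClassical` / `ComparisonAuxClassicalFlipped` (classical comparands) — the INTERMEDIATE
  through which Step 4 is proved (MAP-SCHEMA §1b): `theorem4Bounds_of_barriers'_comparison` (from Step 2′)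
  and `theorem4Bounds_of_barriers_comparison` (from Step 2).
* Step 4 = `Theorem4Bounds vn` (Thm 4, p. 4 l. 350–367) — LOAD-BEARING: the λ-uniform sup bounds Thm 8
  consumes.
* Step 5 = `Remark3Data` (Def 3 / Remark 3, p. 5 l. 368–385, implicit: `Υ_H(T₀/2)` is admissible data).
* Step 6 = `Theorem5SpaceDQ vn` (Thm 5, pp. 5–6 l. 386–556; proof «the same arguments as used in the proof
  of Theorems 2, 3 and 4», l. 530–535).
* Step 7 = `Theorem6TimeDQ vn` (Thm 6 + Cor 1, pp. 6–8 l. 558–669; «essentially the same arguement», l. 635).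
* Step 8 = `Theorem7AllDQ vn` (Thm 7, p. 8 l. 671–709; one-sentence proof «By direct elementary calculation
  and induction», l. 673–674).
* Step 9 = `Theorem8Limit vn` (Thm 8 proof, pp. 8–9 l. 724–767: Arzelà–Ascoli + diagonal + «uniqueness
  theorem for P-viscosity solutions» identification + jet matching at `T₀/2`).
* Step 10 = `Theorem8Gluing` (p. 9 l. 768–771, implicit: the matched pair is a smooth solution on `[0,∞)`).
* Step 11 = `Theorem8Energy` (p. 9 l. 772–779: the integral condition from Thm 1 on `[0,T₀/2)` and from
  «the bounds of Theorems 3,4» beyond).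
* HEADLINE = `ClaimedTheorem` (Thm 8 + l. 779–781 + Cor 2); `claim_of_steps vn : Step 1 → … → Step 11 →
  ClaimedTheorem` PROVED (υ reduced to 1 by the tree's `ClaySpec.regularityAt_iff_regularity`, exactly the
  paper's (3)–(4)); `clay_of_claimed` PROVED.
* COMPOSITION: proved under `F₁ = 0`; FAILS AS PRINTED at Thm 8 p. 9 with `F₁ = p_H` (see F₁ SLOT).

WHAT THIS IS NOT: not a claim about NS regularity or blow-up; not a claim about any author beyond the typed
locator.
-/

noncomputable section

open Set Function MeasureTheory Filter
open scoped ContDiff ENNReal Topology BigOperators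

namespace Literature.Claims.NS.Smith2006

open Literature.Analysis.FluidPDE

/-! ### Vocabulary of §3 (pp. 2–3): the auxiliary λ-system (6) with (7)–(13) -/

/-- Physical space `ℝ³` (Fefferman's `ℝ³`; the tree's `EuclideanSpace ℝ (Fin 3)`). [folklore] -/
abbrev R3 : Type := EuclideanSpace ℝ (Fin 3)

/-- `∂ₖ g (x)` for a scalar field `g : ℝ³ → ℝ` (Fréchet derivative on the standard basis vector `eₖ`;
junk value `0` where `g` is not differentiable — every use below carries the differentiability the print
assumes). [folklore] -/
def pd (g : R3 → ℝ) (k : Fin 3) (x : R3) : ℝ :=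
  fderiv ℝ g x (EuclideanSpace.single k 1)

/-- The 13-component unknown of eq. (7) p. 3, `V = (p, v₁, v₂, v₃, Υ₁₁, …, Υ₃₃)`, as three fields on
space-time `(t, x)`: `P` (the `p`-slot), `v i`, `Υ i j`. [cite: Smith2006, §3 eq. (7) p.3] -/
structure AuxField where
  /-- the `p`-slot -/
  P : ℝ → R3 → ℝ
  /-- the velocity slots `vᵢ` -/
  v : ℝ → R3 → Fin 3 → ℝ
  /-- the gradient slots `Υᵢⱼ` (at λ = 0: `Υᵢⱼ = ∂ⱼvᵢ`) -/
  Υ : ℝ → R3 → Fin 3 → Fin 3 → ℝ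

/-- Cauchy data `W₀ : ℝ³ → ℝ¹³` for the λ-system (Thm 2 / Thm 3, «V(t̂, x) = W₀(x)», pp. 3–4), split like
`AuxField`. [cite: Smith2006, Thm 2 p.3 and Thm 3 p.4] -/
structure AuxData where
  /-- `p`-slot datum -/
  P₀ : R3 → ℝ
  /-- velocity data -/
  v₀ : R3 → Fin 3 → ℝ
  /-- gradient-slot data -/
  Υ₀ : R3 → Fin 3 → Fin 3 → ℝ

/-- The right-hand side `F = (F₁, f₁, f₂, f₃, 0,0,0)` of (6), eq. (13) p. 3 (as printed `F₁ = p`, Heywood's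
pressure, Def 1 p. 2; the composition below uses `F₁ = 0`, see the module docstring, F₁ SLOT). The nine
`Υ`-slots of `F` are `0` as printed and are not carried. [cite: Smith2006, eq. (13) p.3 and Def 1 p.2] -/
structure AuxForce where
  /-- first slot (`p`-row source) -/
  F₁ : ℝ → R3 → ℝ
  /-- the force `f` of the Navier–Stokes system (1) -/
  f : ℝ → R3 → Fin 3 → ℝ

/-- The force the chain uses on `[T₀/2, ∞)`: `f = 0` (Thm 8) and `F₁ = 0` (the reading forced by p. 2
l. 133–135; as printed `F₁ = p_H`). [cite: Smith2006, Thm 8 p.8 («with f = 0») and §3 p.2 l.133–135] -/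
def AuxForce.zero : AuxForce :=
  ⟨fun _ _ => 0, fun _ _ _ => 0⟩

/-- The time-`t` slice of a field, as Cauchy data. [cite: Smith2006, Thm 3 p.4 («V(t̂,x) = W₀»)] -/
def AuxField.slice (V : AuxField) (t : ℝ) : AuxData :=
  ⟨V.P t, V.v t, V.Υ t⟩

/-- Apply an operator on scalar space-time functions (e.g. a difference quotient) to every one of the 13
components. [cite: Smith2006, Thm 7 p.8 («all the difference quotients of V»)] -/
def AuxField.map (φ : (ℝ → R3 → ℝ) → (ℝ → R3 → ℝ)) (V : AuxField) : AuxField :=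
  ⟨φ V.P, fun t x i => φ (fun s y => V.v s y i) t x, fun t x i j => φ (fun s y => V.Υ s y i j) t x⟩

/-- A property of scalar space-time functions holds for ALL 13 components of `V`. [cite: Smith2006, eq. (7) p.3] -/
def AuxField.AllComps (Q : (ℝ → R3 → ℝ) → Prop) (V : AuxField) : Prop :=
  Q V.P ∧ (∀ i, Q fun t x => V.v t x i) ∧ ∀ i j, Q fun t x => V.Υ t x i j

/-- The `p`-row of `L_λ(V) − F` (matrices (8)–(11), (13)): `λ ∂ₜP + ∑ₖ ∂ₖvₖ − F₁` (row 0 of `A₀` is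
`(λ, 0, …)`, of `Aₖ` is `(0, eₖ, 0, 0, 0)`). Time derivative one-sided within the time set `S`.
[cite: Smith2006, eqs. (6) (8)–(11) (13) pp.2–3] -/
def auxResidualP (lam : ℝ) (F : AuxForce) (S : Set ℝ) (V : AuxField) (t : ℝ) (x : R3) : ℝ :=
  lam * derivWithin (fun s => V.P s x) S t + (∑ k, pd (fun y => V.v t y k) k x) - F.F₁ t x

/-- The `vᵢ`-row of `L_λ(V) − F`: `∂ₜvᵢ + ∑ₖ vₖ∂ₖvᵢ + ∂ᵢP − ∑ₖ ∂ₖΥᵢₖ − fᵢ` (row `i` of `Aₖ`: `eₖ*` in the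
`p`-column, `vₖ I₃` on the `v`-block, `−E(i,k)` on the `Υᵢ•`-block; at λ = 0 with `Υ = ∇v` this is (1)
with `υ = 1`). [cite: Smith2006, eqs. (1) p.1, (6) (9)–(11) pp.2–3] -/
def auxResidualV (F : AuxForce) (S : Set ℝ) (V : AuxField) (t : ℝ) (x : R3) (i : Fin 3) : ℝ :=
  derivWithin (fun s => V.v s x i) S t + (∑ k, V.v t x k * pd (fun y => V.v t y i) k x)
    + pd (V.P t) i x - (∑ k, pd (fun y => V.Υ t y i k) k x) - F.f t x i

/-- The `Υᵢⱼ`-row of `L_λ(V) − F`: `λ ∂ₜΥᵢⱼ − ∂ⱼvᵢ + Υᵢⱼ` (`A₀` carries `λ I₃` on each `Υ`-block, row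
`Υᵢⱼ` of `Aⱼ` has `−1` in the `vᵢ`-column, `B` (12) is the identity on the `Υ`-slots, the `Υ`-slots of
`F` vanish). [cite: Smith2006, eqs. (6) (8)–(12) pp.2–3] -/
def auxResidualΥ (lam : ℝ) (S : Set ℝ) (V : AuxField) (t : ℝ) (x : R3) (i j : Fin 3) : ℝ :=
  lam * derivWithin (fun s => V.Υ s x i j) S t - pd (fun y => V.v t y i) j x + V.Υ t x i j

/-- At `λ = 0` the `p`-row residual is `div v − F₁`: it vanishes iff `div v = F₁`. With `F₁ = p_H` as
printed (eq. (13), Def 1) the λ = 0 system is NOT the Navier–Stokes system (p. 2 l. 133–135 says it is);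
with `F₁ = 0` it is (typing fork F₁ SLOT). [cite: Smith2006, eq. (13) p.3 and §3 p.2 l.133–135] -/
theorem auxResidualP_zero_lam (F : AuxForce) (S : Set ℝ) (V : AuxField) (t : ℝ) (x : R3) :
    auxResidualP 0 F S V t x = (∑ k, pd (fun y => V.v t y k) k x) - F.F₁ t x := by
  simp [auxResidualP]

/-- `L_λ(V) − F ≥ 0` componentwise on `S × ℝ³` — for a C² field this is being a (P-viscosity)
SUPERsolution ([Sm3] Def 12 p. 11 with Remark p. 11 l. 1103–1106; [Sm3] Thm 1 p. 2 puts `L(u₁) ≥ 0` on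
top). [cite: Smith2006PerronGeneral, Def 12 and Remark p.11, Thm 1 p.2] -/
def ResidualNonneg (lam : ℝ) (F : AuxForce) (S : Set ℝ) (V : AuxField) : Prop :=
  ∀ t ∈ S, ∀ x, 0 ≤ auxResidualP lam F S V t x ∧ (∀ i, 0 ≤ auxResidualV F S V t x i) ∧
    ∀ i j, 0 ≤ auxResidualΥ lam S V t x i j

/-- `L_λ(V) − F ≤ 0` componentwise on `S × ℝ³` — for a C² field: a (P-viscosity) SUBsolution ([Sm3]
Def 11 p. 11 with Remark p. 11). [cite: Smith2006PerronGeneral, Def 11 and Remark p.11] -/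
def ResidualNonpos (lam : ℝ) (F : AuxForce) (S : Set ℝ) (V : AuxField) : Prop :=
  ∀ t ∈ S, ∀ x, auxResidualP lam F S V t x ≤ 0 ∧ (∀ i, auxResidualV F S V t x i ≤ 0) ∧
    ∀ i j, auxResidualΥ lam S V t x i j ≤ 0

/-- The time domains of the print, «0 ≤ t̂ ≤ t ≤ T ≤ ∞», «D_T = [t̂, T] × ℝ³», «T can be infinite»:
`S = [t̂, T]` with `t̂ < T < ∞`, or `S = [t̂, ∞)`. [cite: Smith2006, Thm 2 p.3 and Thm 3 p.4] -/
def IsTimeSlab (tHat : ℝ) (S : Set ℝ) : Prop :=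
  (∃ T : ℝ, tHat < T ∧ S = Icc tHat T) ∨ S = Ici tHat

/-- `W ∈ C^k(D)` for a scalar space-time function on the slab `D = S × ℝ³` (jointly `C^k` within
`S ×ˢ univ`, the convention of the tree's `IsSmoothSpaceTimeOn`); the print's «V^# ∈ C^{2+ε₀}(D_T,…)»,
«continuous viscosity solution», «vⁱ … are actually C¹». [cite: Smith2006, Thm 2 (1) (2) p.3 and Thm 3 p.4] -/
def IsCkOnSlab (k : WithTop ℕ∞) (S : Set ℝ) (W : ℝ → R3 → ℝ) : Prop :=
  ContDiffOn ℝ k (uncurry W) (S ×ˢ univ)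

/-- `|W| ≤ M` on the slab `S × ℝ³` («bounded with bounds independent of λ»).
[cite: Smith2006, Thm 2 (4) p.3 and Thm 4 p.4] -/
def BoundedBySlab (M : ℝ) (S : Set ℝ) (W : ℝ → R3 → ℝ) : Prop :=
  ∀ t ∈ S, ∀ x, |W t x| ≤ M

/-- `W ∈ H^{2,2}(D_T)`: the space-time derivatives of orders `≤ 2` (within the slab) are square integrable
over `D = S × ℝ³` (lower Lebesgue integrals, no junk value). [cite: Smith2006, Thm 2 (1) (2) p.3
(«C^{2+ε₀}(D_T,ℝ¹³) ∩ H^{2,2}(D_T,ℝ¹³)»)] -/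
def IsH22OnSlab (S : Set ℝ) (W : ℝ → R3 → ℝ) : Prop :=
  ∀ k : ℕ, k ≤ 2 →
    ∫⁻ q in S ×ˢ (univ : Set R3), ‖iteratedFDerivWithin ℝ k (uncurry W) (S ×ˢ univ) q‖ₑ ^ 2 < ⊤

/-- «decaying to zero at spacial infinity» for a scalar space-time function, at each time of `S`.
[cite: Smith2006, Thm 2 (4) p.3 and Thm 4 p.4] -/
def DecaysOnSlab (S : Set ℝ) (W : ℝ → R3 → ℝ) : Prop :=
  ∀ t ∈ S, ∀ ε : ℝ, 0 < ε → ∃ R : ℝ, ∀ x : R3, R ≤ ‖x‖ → |W t x| ≤ ε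

/-- All 13 components `C^k` on the slab. [cite: Smith2006, Thm 2 p.3, Thm 3 p.4] -/
def AuxField.IsCk (k : WithTop ℕ∞) (S : Set ℝ) (V : AuxField) : Prop :=
  V.AllComps (IsCkOnSlab k S)

/-- All 13 components bounded by `M` on the slab («|V| … any finite dimensional pointwise norm», p. 1
l. 44–47; componentwise). [cite: Smith2006, §1 p.1 l.44–47 and Thm 2 (4) p.3] -/
def AuxField.BoundedBy (M : ℝ) (S : Set ℝ) (V : AuxField) : Prop :=
  V.AllComps (BoundedBySlab M S)

/-- All 13 components bounded on the slab. [cite: Smith2006, Thm 2 (4) p.3] -/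
def AuxField.IsBounded (S : Set ℝ) (V : AuxField) : Prop :=
  ∃ M : ℝ, V.BoundedBy M S

/-- All 13 components in `H^{2,2}` of the slab. [cite: Smith2006, Thm 2 (1) (2) p.3] -/
def AuxField.IsH22 (S : Set ℝ) (V : AuxField) : Prop :=
  V.AllComps (IsH22OnSlab S)

/-- All 13 components decay at spatial infinity at each time. [cite: Smith2006, Thm 2 (4) p.3] -/
def AuxField.Decays (S : Set ℝ) (V : AuxField) : Prop :=
  V.AllComps (DecaysOnSlab S)

/-- Two fields agree on the slab `S × ℝ³` (the content of «unique» in Thm 3 p. 4).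
[cite: Smith2006, Thm 3 p.4] -/
def AuxField.EqOnSlab (S : Set ℝ) (V V' : AuxField) : Prop :=
  ∀ t ∈ S, ∀ x, V.P t x = V'.P t x ∧ (∀ i, V.v t x i = V'.v t x i) ∧ ∀ i j, V.Υ t x i j = V'.Υ t x i j

/-- Componentwise order on the slab, `V₂ ≤ V₁` — the only order in [Sm3] («u₁ ≥ u₂ in D_T», Thm 1 p. 2,
Thm 4 p. 10). [cite: Smith2006PerronGeneral, Thm 1 p.2 and Thm 4 p.10] -/
def AuxField.Below (S : Set ℝ) (V₂ V₁ : AuxField) : Prop :=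
  ∀ t ∈ S, ∀ x, V₂.P t x ≤ V₁.P t x ∧ (∀ i, V₂.v t x i ≤ V₁.v t x i) ∧ ∀ i j, V₂.Υ t x i j ≤ V₁.Υ t x i j

/-- `g ∈ C^∞(ℝ³) ∩ H^{m,2}(ℝ³) ∀ m` for a scalar field: smooth with every derivative square integrable — the
data class of Thm 1 p. 2, used here for each component of `W₀` (NARROWED from the printed
`C^{2+ε₀} ∩ H^{3,2}` of Thms 2–3 to what the chain feeds in, `Υ_H(T₀/2)`; narrowing a hypothesis class makes
the typed steps weaker than printed). [cite: Smith2006, Thm 1 p.2 l.88–89, Thm 2 p.3, Thm 3 p.4] -/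
def IsHInftyScalar (g : R3 → ℝ) : Prop :=
  ContDiff ℝ ∞ g ∧ ∀ n : ℕ, ∫⁻ x, ‖iteratedFDeriv ℝ n g x‖ₑ ^ 2 < ⊤

/-- Admissible Cauchy data for Thms 2–4: every component in `C^∞ ∩ H^∞` (see `IsHInftyScalar`).
[cite: Smith2006, Thm 2 p.3 («W₀ ∈ C^{2+ε₀}(ℝ³,ℝ¹³) ∩ H^{3,2}(ℝ³,ℝ¹³)»)] -/
def AuxData.IsAdmissible (W₀ : AuxData) : Prop :=
  IsHInftyScalar W₀.P₀ ∧ (∀ i, IsHInftyScalar fun x => W₀.v₀ x i) ∧ ∀ i j, IsHInftyScalar fun x => W₀.Υ₀ x i j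

/-- Admissible right-hand sides for Thms 2–4: «F continuous and bounded and decaying to zero at spacial
infinity» (decay typed uniformly in `t ∈ S` — the stronger hypothesis, hence weaker steps; the chain uses
`F ≡ 0`). [cite: Smith2006, Thm 2 p.3 l.273–274] -/
def AuxForce.IsAdmissible (S : Set ℝ) (F : AuxForce) : Prop :=
  (ContinuousOn (uncurry F.F₁) (S ×ˢ univ) ∧ ∀ i, ContinuousOn (uncurry fun t x => F.f t x i) (S ×ˢ univ)) ∧
  (∃ M : ℝ, BoundedBySlab M S F.F₁ ∧ ∀ i, BoundedBySlab M S fun t x => F.f t x i) ∧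
  ∀ ε : ℝ, 0 < ε → ∃ R : ℝ, ∀ t ∈ S, ∀ x : R3, R ≤ ‖x‖ → |F.F₁ t x| ≤ ε ∧ ∀ i, |F.f t x i| ≤ ε

/-- **The solution notion as a hypothesis structure.** A `PViscosityNotion` assigns to each λ-system
(`λ`, right-hand side `F`, time set `S`) its P-viscosity sub- and supersolutions, subject ONLY to the two
printed facts the chain uses: a field that is C² on the slab, bounded, in `H^{2,2}`, with residual
`L_λ(V) − F ≤ 0` (resp. `≥ 0`) componentwise is a subsolution (resp. supersolution) — [Sm3] Remark p. 11
l. 1103–1106, v4 p. 9 l. 747–748, and the application of the comparison principle to the Thm 2 barriers in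
the proof of Thm 4 p. 4 l. 364–367. The paper's own notion ([Sm3] Defs 9–16, [Sm1] Def 18) is one such
structure; it is not constructed here. [cite: Smith2006PerronGeneral, Defs 9–16 and Remark pp.10–11] -/
structure PViscosityNotion where
  /-- `V` is a P-viscosity subsolution of `L_λ(·) = F` on `S × ℝ³` -/
  IsSub : ℝ → AuxForce → Set ℝ → AuxField → Prop
  /-- `V` is a P-viscosity supersolution of `L_λ(·) = F` on `S × ℝ³` -/
  IsSuper : ℝ → AuxForce → Set ℝ → AuxField → Prop
  /-- classical (C², bounded, `H^{2,2}`) fields with residual `≤ 0` are subsolutions -/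
  sub_of_classical : ∀ (lam : ℝ) (F : AuxForce) (S : Set ℝ) (V : AuxField),
    V.IsCk 2 S → V.IsBounded S → V.IsH22 S → ResidualNonpos lam F S V → IsSub lam F S V
  /-- classical (C², bounded, `H^{2,2}`) fields with residual `≥ 0` are supersolutions -/
  super_of_classical : ∀ (lam : ℝ) (F : AuxForce) (S : Set ℝ) (V : AuxField),
    V.IsCk 2 S → V.IsBounded S → V.IsH22 S → ResidualNonneg lam F S V → IsSuper lam F S V

/-- A continuous (P-viscosity) SOLUTION: continuous on the slab and both a sub- and a supersolution ([Sm3]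
Defs 15–16 p. 11; v4 p. 9 l. 754–755 «a P-solution is both a P-Subsolution and a P-supersolution»).
[cite: Smith2006PerronGeneral, Defs 15–16 p.11] -/
def PViscosityNotion.IsSol (vn : PViscosityNotion) (lam : ℝ) (F : AuxForce) (S : Set ℝ) (V : AuxField) :
    Prop :=
  V.IsCk 0 S ∧ vn.IsSub lam F S V ∧ vn.IsSuper lam F S V

/-! ### Step 1 — Theorem 1 [Heywood] (p. 2) -/

/-- The conclusion of Thm 1 p. 2 for a triple `(T₀, u, p)`: a smooth solution of the Navier–Stokes system
(1), (2) with `υ = 1` («THE Navier-Stokes System», p. 2 l. 78–81) and force `f` on `[0, T₀) × ℝ³` with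
`u(0) = u⁰`, such that (5c) «for each t̄ ∈ [0, T₀) all space and time derivatives `D^α_x D^β_t p`,
`D^α_x D^β_t u` are square integrable in space over `{t̄} × ℝ³`» ((5a), (5b) = the joint smoothness inside
`IsClassicalNSSolutionOn`). [cite: Smith2006, Thm 1 (5a)–(5c) p.2 l.87–114] -/
structure IsHeywoodTriple (T₀ : ℝ) (f : ℝ → R3 → R3) (u₀ : R3 → R3) (u : ℝ → R3 → R3)
    (p : ℝ → R3 → ℝ) : Prop where
  /-- `T₀ > 0` -/
  pos : 0 < T₀
  /-- (1), (2) with `υ = 1`, (5a), (5b) on `[0, T₀) × ℝ³` -/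
  sol : IsClassicalNSSolutionOn (Ico 0 T₀) 1 f u p
  /-- `u(0) = u⁰` -/
  initial : u 0 = u₀
  /-- (5c) for `u`: `D^n_x D^β_t u(t̄, ·) ∈ L²(ℝ³)` -/
  sqInt_u : ∀ t ∈ Ico 0 T₀, ∀ β n : ℕ,
    ∫⁻ x, ‖iteratedFDeriv ℝ n (fun y => iteratedDerivWithin β (fun s => u s y) (Ico 0 T₀) t) x‖ₑ ^ 2 < ⊤
  /-- (5c) for `p` -/
  sqInt_p : ∀ t ∈ Ico 0 T₀, ∀ β n : ℕ,
    ∫⁻ x, ‖iteratedFDeriv ℝ n (fun y => iteratedDerivWithin β (fun s => p s y) (Ico 0 T₀) t) x‖ₑ ^ 2 < ⊤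

/-- The data class of Thm 1 / Thm 8 ON TOP of smoothness and `div u⁰ = 0`: «u⁰ ∈ H^{m,2}(ℝ³) ∩ C^∞(ℝ³)
∀ m ∈ Z⁺» — every derivative in `L²` (the slot `smithSpec.data`; Clay (4) data belong to it,
`HasRapidSpatialDecay.lintegral_enorm_iteratedFDeriv_sq_lt_top`). Divergence-freeness is not printed in
Thm 1's hypothesis; (2) at `t = 0` forces it and (A) has it. [cite: Smith2006, Thm 1 p.2 l.88–89] -/
def IsSmithDatum (u₀ : R3 → R3) : Prop :=
  ContDiff ℝ ∞ u₀ ∧ NSWave0.IsDivFree u₀ ∧ ∀ n : ℕ, ∫⁻ x, ‖iteratedFDeriv ℝ n u₀ x‖ₑ ^ 2 < ⊤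

/-- **Step 1 — Theorem 1 [Heywood]** (p. 2 l. 87–115): for `u⁰ ∈ H^{m,2} ∩ C^∞ ∀ m` (and divergence
free) and `f ∈ C^∞([0,∞] × ℝ³)` with `|∂^α_x ∂^m_t f| ≤ C_{αmk}(1+|x|+t)^{−k}` (= Clay (5), the tree's
`HasRapidSpaceTimeDecay`), there are `T₀ > 0` and a solution `(u, p)` on `[0, T₀) × ℝ³` with (5a)–(5c).
«Proof: This is less than proved in the brilliant paper of [H].» Classical (Heywood, Indiana Univ. Math.
J. 29 (1980) 639–681); the tree's `tao2011_smooth_local_existence_holds` gives the `f = 0` existence with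
all spatial Sobolev norms bounded. Typist's flag: true (cited classical theorem).
[cite: Smith2006, Thm 1 p.2] -/
def Theorem1Heywood : Prop :=
  ∀ u₀ : R3 → R3, IsSmithDatum u₀ →
    ∀ f : ℝ → R3 → R3, IsSmoothOnHalfSpace f → HasRapidSpaceTimeDecay f →
      ∃ (T₀ : ℝ) (u : ℝ → R3 → R3) (p : ℝ → R3 → ℝ), IsHeywoodTriple T₀ f u₀ u p

/-! ### Step 2 — Theorem 2 (pp. 3–4): λ-independent C² sub- and supersolutions -/

/-- **Step 2 — Theorem 2** (pp. 3–4, l. 266–317). For `0 ≤ t̂`, a time domain `D_T = [t̂,T] × ℝ³` with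
`T ≤ ∞`, data `W₀` and an admissible `F`: «(1) a supersolution V^# ∈ C^{2+ε₀}(D_T,ℝ¹³) ∩ H^{2,2}(D_T,ℝ¹³)
of eq (6) with V^#(t̂,x) = W₀(x). (2) a subsolution U_# … with U_#(t̂,x) = W₀(x). (3) At no loss of
generality V^# and U_# can be chosen independently of λ. (4) Since |F| is bounded and decaying to zero at
spacial infinity, then so are |V^#| and |U_#|, with bounds independent of λ.» — for all `0 < λ < 1/4`. Typed:
ONE pair `(V^#, U_#)` and ONE bound `M`, outside the quantifier over `λ` ((3), (4)); C² in place of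
`C^{2+ε₀}` (weaker); sub/super = residual sign (classical, [Sm3] Remark p. 11). PROOF IMPORTED: «This is
done by the same proofs as in Theorems 15, 20 of [Sm2]. See also the errata [Sm4]» (l. 292–316) — sources
not held (acq-11446, acq-11447). Typist's flag: suspicious (bounded `H^{2,2}(D_∞)` barriers with prescribed
data, uniformly in λ, from a three-sentence adaptation of an unavailable proof; note the `Υ`-rows at
`t = t̂`: `λ ∂ₜΥ^#ᵢⱼ(t̂,·) ≥ ∂ⱼv₀,ᵢ − Υ₀,ᵢⱼ` for EVERY `λ < 1/4` with a λ-independent `Υ^#` — the chain's own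
data `Υ_H(T₀/2)` has `Υ₀ = ∇v₀`, `div v₀ = 0`, `F = 0`, where this initial layer is compatible). The
CHARITABLE reading of (3) — barriers may depend on `λ`, only the bound is uniform — is `Theorem2Barriers'`
(`theorem2Barriers'_of_literal`); the instance the chain consumes is `Theorem2BarriersHeywood`.
[cite: Smith2006, Thm 2 (1)–(4) pp.3–4] -/
def Theorem2Barriers : Prop :=
  ∀ (tHat : ℝ) (S : Set ℝ) (W₀ : AuxData) (F : AuxForce),
    0 ≤ tHat → IsTimeSlab tHat S → W₀.IsAdmissible → F.IsAdmissible S →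
      ∃ (Vsup Usub : AuxField) (M : ℝ),
        (Vsup.IsCk 2 S ∧ Vsup.IsH22 S ∧ Vsup.slice tHat = W₀ ∧ Vsup.BoundedBy M S ∧ Vsup.Decays S) ∧
        (Usub.IsCk 2 S ∧ Usub.IsH22 S ∧ Usub.slice tHat = W₀ ∧ Usub.BoundedBy M S ∧ Usub.Decays S) ∧
        ∀ lam : ℝ, 0 < lam → lam < 1 / 4 → ResidualNonneg lam F S Vsup ∧ ResidualNonpos lam F S Usub

/-- **Step 2′ — Theorem 2, CHARITABLE reading of item (3)** (pp. 3–4): for each `0 < λ < 1/4` there are C²,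
`H^{2,2}` barriers `V^#_λ ≥` / `U_#,λ ≤` with the data `W₀` at `t̂`, ALL bounded by ONE λ-independent `M`
and decaying (item (4) «with bounds independent of λ»); the pair itself may depend on `λ` (reading (3) «can
be chosen independently of λ» as referring to the bounds the sequel uses). Weaker than `Theorem2Barriers`;
it is all that the printed proof of Thm 4 consumes (`theorem4Bounds_of_barriers'_comparison`). Typist's
flag: suspicious (open; rests on the unheld [Sm2] Thms 15, 20, stated there for diagonal systems, [Sm3]
p. 1 l. 36–42). [cite: Smith2006, Thm 2 (1)–(4) pp.3–4] -/
def Theorem2Barriers' : Prop :=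
  ∀ (tHat : ℝ) (S : Set ℝ) (W₀ : AuxData) (F : AuxForce),
    0 ≤ tHat → IsTimeSlab tHat S → W₀.IsAdmissible → F.IsAdmissible S →
      ∃ M : ℝ, ∀ lam : ℝ, 0 < lam → lam < 1 / 4 →
        ∃ Vsup Usub : AuxField,
          (Vsup.IsCk 2 S ∧ Vsup.IsH22 S ∧ Vsup.slice tHat = W₀ ∧ Vsup.BoundedBy M S ∧ Vsup.Decays S) ∧
          (Usub.IsCk 2 S ∧ Usub.IsH22 S ∧ Usub.slice tHat = W₀ ∧ Usub.BoundedBy M S ∧ Usub.Decays S) ∧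
          ResidualNonneg lam F S Vsup ∧ ResidualNonpos lam F S Usub

/-- The literal reading of Thm 2 implies the charitable one. [cite: Smith2006, Thm 2 (3) (4) p.3] -/
theorem theorem2Barriers'_of_literal (h : Theorem2Barriers) : Theorem2Barriers' := by
  intro tHat S W₀ F ht hS hW hF
  obtain ⟨Vsup, Usub, M, hV, hU, hsign⟩ := h tHat S W₀ F ht hS hW hF
  exact ⟨M, fun lam h0 h1 => ⟨Vsup, Usub, hV, hU, (hsign lam h0 h1).1, (hsign lam h0 h1).2⟩⟩

/-! ### Step 3 — Theorem 3 (p. 4): eternal unique continuous viscosity solution, `vⁱ ∈ C¹` -/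

/-- Theorem 3, existence and regularity half (p. 4 l. 321–333): for `0 < λ < 1/4`, `0 ≤ t̂`, `T ≤ ∞`,
admissible `W₀`, `F`: «there exists a unique continuous viscosity solution V of L_λ(V) = F, with
V(t̂,x) = W₀. Moreover, the vⁱ, i = 1,2,3 are actually C¹.» — here: a continuous `vn`-solution with the data
and C¹ velocity slots. Printed proof: «the system eq (6) is exactly of the form to which Theorem 5 page 11 of
[Sm3] applies and, by Theorem 2 of the current paper, we have such a P-viscosity solution» ([Sm3] Thm 5 p. 10
= «Theorem 1 of [Sm5] obtains» under the Positivity Hypothesis, i.e. the Perron existence theorem of JMAA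
Part II — source wanted acq-11446); C¹ by «Remark 10 page 14 [Sm3] to Theorem 11 page 16». Typist's flag:
plausible-unverifiable (imported from an unavailable source; global existence for a quasilinear hyperbolic
system). [cite: Smith2006, Thm 3 p.4 l.321–348] -/
def Theorem3Exists (vn : PViscosityNotion) : Prop :=
  ∀ (lam tHat : ℝ) (S : Set ℝ) (W₀ : AuxData) (F : AuxForce),
    0 < lam → lam < 1 / 4 → 0 ≤ tHat → IsTimeSlab tHat S → W₀.IsAdmissible → F.IsAdmissible S →
      ∃ V : AuxField, vn.IsSol lam F S V ∧ V.slice tHat = W₀ ∧ ∀ i, IsCkOnSlab 1 S fun t x => V.v t x i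

/-- Theorem 3, uniqueness half (p. 4: «unique»; = [Sm3] Thm 6 pp. 10–11, whose printed proof is «u₁, u₂
are both viscosity super and subsolutions with the same Cauchy data. Thus, Theorem 1 implies that u₁ ≥ u₂
and u₂ ≥ u₁» — i.e. the comparison principle: `theorem3Unique_of_comparison`). Consumed by Thms 5, 6
(«W = D_h(V)») and by Thm 8's identification of limits (p. 9 l. 750–757).
[cite: Smith2006, Thm 3 p.4] [cite: Smith2006PerronGeneral, Thm 6 pp.10–11] -/
def Theorem3Unique (vn : PViscosityNotion) : Prop :=
  ∀ (lam tHat : ℝ) (S : Set ℝ) (W₀ : AuxData) (F : AuxForce),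
    0 < lam → lam < 1 / 4 → 0 ≤ tHat → IsTimeSlab tHat S → W₀.IsAdmissible → F.IsAdmissible S →
      ∀ V V' : AuxField, vn.IsSol lam F S V → V.slice tHat = W₀ → vn.IsSol lam F S V' → V'.slice tHat = W₀ →
        V.EqOnSlab S V'

/-- **Step 3 — Theorem 3** (p. 4) = existence-with-C¹-velocity ∧ uniqueness. [cite: Smith2006, Thm 3 p.4] -/
def Theorem3 (vn : PViscosityNotion) : Prop :=
  Theorem3Exists vn ∧ Theorem3Unique vn

/-! ### Support (intermediate of Step 4) — the imported comparison principle, [Sm3] Thm 4 p. 10 -/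

/-- The operator of a «*-admissible first order Quasilinear Symmetric Hyperbolic System» ([Sm3] Def 3
p. 2): `L(u) := A⁰(t,x,u)∂ₜu + Aⁱ(t,x,u)∂ᵢu − B(u) − f(t,x)` on `ℝ × ℝⁿ` with values in `ℝ^N`
(`A 0` = `A⁰`, `A i.succ` = `Aⁱ`; time derivative within `S`). [cite: Smith2006PerronGeneral, Def 3 p.2] -/
def sm3Residual {n N : ℕ}
    (A : Fin (n + 1) → ℝ → EuclideanSpace ℝ (Fin n) → (Fin N → ℝ) → Matrix (Fin N) (Fin N) ℝ)
    (B : (Fin N → ℝ) → (Fin N → ℝ)) (f : ℝ → EuclideanSpace ℝ (Fin n) → (Fin N → ℝ)) (S : Set ℝ)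
    (u : ℝ → EuclideanSpace ℝ (Fin n) → (Fin N → ℝ)) (t : ℝ) (x : EuclideanSpace ℝ (Fin n)) : Fin N → ℝ :=
  (A 0 t x (u t x)).mulVec (derivWithin (fun s => u s x) S t) +
    (∑ i : Fin n, (A i.succ t x (u t x)).mulVec (fderiv ℝ (u t) x (EuclideanSpace.single i 1))) -
    B (u t x) - f t x

/-- [Sm3] Thm 4 p. 10 (comparison principle for viscosity sub/supersolutions) RESTRICTED TO CLASSICAL C²
COMPARANDS, in the printed generality of [Sm3] §2: `Aᵅ` symmetric, `A⁰` positive definite (Def 1), smooth;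
`B` smooth (Def 3); `f` smooth (Def 2); spatial dimension `n` odd, `n ≥ 3` (abstract; Thm 6); «D_T (where
T > 0 and T can be infinite)»; data «w₀ ∈ C^{2+ε₀} ∩ H^{3,2}» narrowed to `C^∞ ∩ H^∞`; comparands C² on the
slab and in `L¹ ∩ L^∞` (the standing class of Defs 10–11); «t = 0 space-like» and «*-admissible for u₁, u₂»
follow from `A⁰ > 0`. Sign placement by the parameter `sgn`: `sgn = 1` is [Sm3] Thm 1 p. 2 / Defs 11–12
(`L(u₁) ≥ 0`, `L(u₂) ≤ 0`), `sgn = −1` is the literal text of Thm 4 p. 10; conclusion «u₁ ≥ u₂ in D_T»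
componentwise. Printed proof: «follows directly from Theorem 23 [Sm4] with Theorem 1 (of the current paper)
replacing Theorem 22 [Sm4], and Theorem 18 of Appendix E and Theorem 19 of Appendix F replacing
approximation theorems 15 and 20 of [Sm5]». [cite: Smith2006PerronGeneral, Thm 4 p.10, Thm 1 p.2, Defs 1–3 p.2] -/
def Sm3ComparisonShape (sgn : ℝ) : Prop :=
  ∀ (n N : ℕ), Odd n → 3 ≤ n →
  ∀ (A : Fin (n + 1) → ℝ → EuclideanSpace ℝ (Fin n) → (Fin N → ℝ) → Matrix (Fin N) (Fin N) ℝ)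
    (B : (Fin N → ℝ) → (Fin N → ℝ)) (f : ℝ → EuclideanSpace ℝ (Fin n) → (Fin N → ℝ)),
    (∀ α t x z, (A α t x z).IsSymm) → (∀ t x z, (A 0 t x z).PosDef) →
    (∀ α i j, ContDiff ℝ ∞ fun q : ℝ × EuclideanSpace ℝ (Fin n) × (Fin N → ℝ) => A α q.1 q.2.1 q.2.2 i j) →
    ContDiff ℝ ∞ B → ContDiff ℝ ∞ (uncurry f) →
  ∀ S : Set ℝ, IsTimeSlab 0 S →
  ∀ w₀ : EuclideanSpace ℝ (Fin n) → Fin N → ℝ,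
    ContDiff ℝ ∞ w₀ → (∀ k : ℕ, ∫⁻ x, ‖iteratedFDeriv ℝ k w₀ x‖ₑ ^ 2 < ⊤) →
  ∀ u₁ u₂ : ℝ → EuclideanSpace ℝ (Fin n) → Fin N → ℝ,
    ContDiffOn ℝ 2 (uncurry u₁) (S ×ˢ univ) → ContDiffOn ℝ 2 (uncurry u₂) (S ×ˢ univ) →
    (∫⁻ q in S ×ˢ (univ : Set (EuclideanSpace ℝ (Fin n))), ‖uncurry u₁ q‖ₑ < ⊤) →
    (∫⁻ q in S ×ˢ (univ : Set (EuclideanSpace ℝ (Fin n))), ‖uncurry u₂ q‖ₑ < ⊤) →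
    (∃ M : ℝ, ∀ t ∈ S, ∀ x, ‖u₁ t x‖ ≤ M ∧ ‖u₂ t x‖ ≤ M) →
    (∀ t ∈ S, ∀ x c, 0 ≤ sgn * sm3Residual A B f S u₁ t x c) →
    (∀ t ∈ S, ∀ x c, sgn * sm3Residual A B f S u₂ t x c ≤ 0) →
    u₁ 0 = w₀ → u₂ 0 = w₀ →
      ∀ t ∈ S, ∀ x c, u₂ t x c ≤ u₁ t x c

/-- [Sm3] Thm 4 p. 10, classical comparands, sign convention of [Sm3] Thm 1 p. 2 / Defs 11–12 (`L(u₁) ≥ 0`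
on top). [cite: Smith2006PerronGeneral, Thm 4 p.10 with Thm 1 p.2] -/
def Sm3Theorem4General : Prop :=
  Sm3ComparisonShape 1

/-- [Sm3] Thm 4 p. 10, classical comparands, the LITERAL sign text («supersolution of L⁺(u₁) ≤ 0 …
subsolution of L⁻ ≥ 0 … Then u₁ ≥ u₂»). [cite: Smith2006PerronGeneral, Thm 4 p.10] -/
def Sm3Theorem4GeneralFlipped : Prop :=
  Sm3ComparisonShape (-1)

/-- The comparison principle AS INVOKED in the proof of Thm 4 p. 4 (l. 364–367: «This follows by applying
(for each λ) the comparison principle given as Theorem 4 of [SM3]») — instantiated on system (6) with an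
admissible `F` (v4 Remark 4 p. 5 l. 509–518 relaxes [Sm3]'s smooth `f` to «bounded and continuous and
decaying at spacial infinity»), at the notion level: a `vn`-supersolution and a `vn`-subsolution with the
same admissible data at `t̂` are ordered on the whole slab. This is the INTERMEDIATE through which Step 4
is proved (MAP-SCHEMA §1b): `theorem4Bounds_of_barriers_comparison`.
[cite: Smith2006, Thm 4 proof p.4 l.364–367] [cite: Smith2006PerronGeneral, Thm 4 p.10] -/
def ComparisonAux (vn : PViscosityNotion) : Prop :=
  ∀ (lam tHat : ℝ) (S : Set ℝ) (W₀ : AuxData) (F : AuxForce),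
    0 < lam → lam < 1 / 4 → 0 ≤ tHat → IsTimeSlab tHat S → W₀.IsAdmissible → F.IsAdmissible S →
      ∀ V₁ V₂ : AuxField, vn.IsSuper lam F S V₁ → vn.IsSub lam F S V₂ →
        V₁.slice tHat = W₀ → V₂.slice tHat = W₀ → V₂.Below S V₁

/-- `ComparisonAux` for CLASSICAL comparands (C² on the slab, bounded, `H^{2,2}`, residual signs
pointwise; convention `L(V₁) − F ≥ 0` on top) — notion-free; implied by `ComparisonAux vn` for every `vn`
(`comparisonAuxClassical_of`), so a kernel countermodel here refutes the printed principle as used.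
[cite: Smith2006, Thm 4 proof p.4] [cite: Smith2006PerronGeneral, Thm 4 p.10 and Remark p.11] -/
def ComparisonAuxClassical : Prop :=
  ∀ (lam tHat : ℝ) (S : Set ℝ) (W₀ : AuxData) (F : AuxForce),
    0 < lam → lam < 1 / 4 → 0 ≤ tHat → IsTimeSlab tHat S → W₀.IsAdmissible → F.IsAdmissible S →
      ∀ V₁ V₂ : AuxField,
        V₁.IsCk 2 S → V₁.IsBounded S → V₁.IsH22 S → ResidualNonneg lam F S V₁ →
        V₂.IsCk 2 S → V₂.IsBounded S → V₂.IsH22 S → ResidualNonpos lam F S V₂ →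
        V₁.slice tHat = W₀ → V₂.slice tHat = W₀ → V₂.Below S V₁

/-- The same with the LITERAL signs of [Sm3] Thm 4 p. 10 (`L(V₁) − F ≤ 0` for the top comparand).
[cite: Smith2006PerronGeneral, Thm 4 p.10] -/
def ComparisonAuxClassicalFlipped : Prop :=
  ∀ (lam tHat : ℝ) (S : Set ℝ) (W₀ : AuxData) (F : AuxForce),
    0 < lam → lam < 1 / 4 → 0 ≤ tHat → IsTimeSlab tHat S → W₀.IsAdmissible → F.IsAdmissible S →
      ∀ V₁ V₂ : AuxField,
        V₁.IsCk 2 S → V₁.IsBounded S → V₁.IsH22 S → ResidualNonpos lam F S V₁ →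
        V₂.IsCk 2 S → V₂.IsBounded S → V₂.IsH22 S → ResidualNonneg lam F S V₂ →
        V₁.slice tHat = W₀ → V₂.slice tHat = W₀ → V₂.Below S V₁

/-! ### Step 4 — Theorem 4 (p. 4): λ-independent bounds (LOAD-BEARING) -/

/-- The conclusion of Thm 4 p. 4 at fixed `(F, D_T, t̂, W₀)`: ONE constant `C` («bounds depending only on
the "initial" (at t = t̂) data and |F|. These bounds are independent of λ») bounding `|vᵢ|`, `|Υᵢⱼ|` of
every `vn`-solution with data `W₀`, for every `0 < λ < 1/4`, plus «decaying to zero at spacial infinity».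
The `p`-slot is NOT bounded by Thm 4 (Remark 7 p. 7). [cite: Smith2006, Thm 4 p.4 l.350–363] -/
def Thm4Conclusion (vn : PViscosityNotion) (F : AuxForce) (S : Set ℝ) (tHat : ℝ) (W₀ : AuxData) : Prop :=
  ∃ C : ℝ, ∀ lam : ℝ, 0 < lam → lam < 1 / 4 →
    ∀ V : AuxField, vn.IsSol lam F S V → V.slice tHat = W₀ →
      (∀ t ∈ S, ∀ x, (∀ i, |V.v t x i| ≤ C) ∧ ∀ i j, |V.Υ t x i j| ≤ C) ∧
      (∀ i, DecaysOnSlab S fun t x => V.v t x i) ∧ ∀ i j, DecaysOnSlab S fun t x => V.Υ t x i j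

/-- **Step 4 — Theorem 4** (p. 4 l. 350–363): «Under the hypothesis of Theorem 3, since |F| is bounded,
then |vᵢ| and |Υᵢⱼ| are bounded with bounds depending only on the "initial" (at t = t̂) data and |F|. These
bounds are independent of λ. Thus, since |F| is decaying to zero at spacial infinity, so are |vᵢ| and
|Υᵢⱼ|.» LOAD-BEARING: these are the order-zero bounds Thm 8 consumes (Arzelà–Ascoli, the integral
condition). Printed proof (l. 364–367): Thm 2 barriers + the comparison principle [Sm3] Thm 4 —
kernel-checked as `theorem4Bounds_of_barriers_comparison`. At λ ↓ 0 with `F = 0` the statement is a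
λ-uniform Lipschitz a-priori bound (referee R#1/R#2). Typist's flag: suspicious (PREDICTED locator class,
CARD §4). [cite: Smith2006, Thm 4 p.4] -/
def Theorem4Bounds (vn : PViscosityNotion) : Prop :=
  ∀ (tHat : ℝ) (S : Set ℝ) (W₀ : AuxData) (F : AuxForce),
    0 ≤ tHat → IsTimeSlab tHat S → W₀.IsAdmissible → F.IsAdmissible S → Thm4Conclusion vn F S tHat W₀

/-! ### Step 5 — Definition 3 / Remark 3 (p. 5): the data of the auxiliary problem -/

/-- «The first prolongation of Heywood's solution» Υ_H (eq. (14) p. 5: `(u¹,u²,u³, ∂u¹/∂x₁, …, ∂u³/∂x₃)`,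
12 components) at `t = T₀/2`, completed to 13 components by the `p`-slot `p_H(T₀/2)` (natural
reconstruction, typing fork DATA). [cite: Smith2006, Def 3 eq. (14) and Remark 3 p.5] -/
def heywoodData (T₀ : ℝ) (u : ℝ → R3 → R3) (p : ℝ → R3 → ℝ) : AuxData :=
  ⟨p (T₀ / 2), fun x i => u (T₀ / 2) x i, fun x i j => pd (fun y => u (T₀ / 2) y i) j x⟩

/-- **Step 5 — Remark 3** (p. 5 l. 381–385, implicit): «we take the W₀ in Theorem 3 to be Υ_H(T₀/2, x)» —
i.e. for every Heywood triple, `Υ_H(T₀/2)` (with the `p`-slot) is admissible data for Thms 2–4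
(`C^{2+ε₀} ∩ H^{3,2}`, here `C^∞ ∩ H^∞`). True and classical from Thm 1 (5c). Typist's flag: true
(routine). [cite: Smith2006, Def 3 and Remark 3 p.5] -/
def Remark3Data : Prop :=
  ∀ (u₀ : R3 → R3) (T₀ : ℝ) (u : ℝ → R3 → R3) (p : ℝ → R3 → ℝ),
    IsSmithDatum u₀ → IsHeywoodTriple T₀ 0 u₀ u p → (heywoodData T₀ u p).IsAdmissible

/-- **Step 2″ — Theorem 2 AT THE INSTANCE THE CHAIN CONSUMES** (Thm 2 pp. 3–4 with Remark 3 p. 5 and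
Thms 5–8: `t̂ = T₀/2`, `D_∞ = [T₀/2, ∞) × ℝ³`, `W₀ = Υ_H(T₀/2)`, `F = F_H` read as `0`), charitable
λ-dependence as in `Theorem2Barriers'`. Here the initial layer is compatible (`Υ₀ = ∇v₀`, `div v₀ = 0`,
`F = 0`), so a countermodel to `Theorem2Barriers` built from incompatible data does not touch this
instance; it follows from `Theorem2Barriers'` and `Remark3Data` (`theorem2BarriersHeywood_of`). Typist's
flag: suspicious (open). [cite: Smith2006, Thm 2 pp.3–4 with Remark 3 p.5] -/
def Theorem2BarriersHeywood : Prop :=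
  ∀ (u₀ : R3 → R3) (T₀ : ℝ) (u : ℝ → R3 → R3) (p : ℝ → R3 → ℝ),
    IsSmithDatum u₀ → IsHeywoodTriple T₀ 0 u₀ u p →
      ∃ M : ℝ, ∀ lam : ℝ, 0 < lam → lam < 1 / 4 →
        ∃ Vsup Usub : AuxField,
          (Vsup.IsCk 2 (Ici (T₀ / 2)) ∧ Vsup.IsH22 (Ici (T₀ / 2)) ∧ Vsup.slice (T₀ / 2) = heywoodData T₀ u p ∧
            Vsup.BoundedBy M (Ici (T₀ / 2)) ∧ Vsup.Decays (Ici (T₀ / 2))) ∧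
          (Usub.IsCk 2 (Ici (T₀ / 2)) ∧ Usub.IsH22 (Ici (T₀ / 2)) ∧ Usub.slice (T₀ / 2) = heywoodData T₀ u p ∧
            Usub.BoundedBy M (Ici (T₀ / 2)) ∧ Usub.Decays (Ici (T₀ / 2))) ∧
          ResidualNonneg lam AuxForce.zero (Ici (T₀ / 2)) Vsup ∧
            ResidualNonpos lam AuxForce.zero (Ici (T₀ / 2)) Usub

/-! ### Steps 6–8 — Theorems 5, 6 (+ Corollary 1), 7 (pp. 5–8): difference-quotient bounds -/

/-- The forward difference quotient of step `h` in the direction `e_α` (p. 5 l. 388–397: `e₀, e₁, e₂, e₃`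
the rows of the 4 × 4 identity; `none` = time `e₀`, `some k` = space `e_{k+1}`):
`D_{h e₀}W(t,x) = (W(t+h,x) − W(t,x))/h`, `D_{h eₖ}W(t,x) = (W(t, x + h eₖ) − W(t,x))/h`.
[cite: Smith2006, §6 p.5 l.388–397] -/
def dq (h : ℝ) : Option (Fin 3) → (ℝ → R3 → ℝ) → ℝ → R3 → ℝ
  | none, W => fun t x => (W (t + h) x - W t x) / h
  | some k, W => fun t x => (W t (x + h • EuclideanSpace.single k 1) - W t x) / h

/-- Iterated («all orders in space and time (including the mixed orders)», Thm 7 p. 8) forward difference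
quotients along a list of directions. [cite: Smith2006, Thm 7 p.8] -/
def dqIter (h : ℝ) (dirs : List (Option (Fin 3))) (W : ℝ → R3 → ℝ) : ℝ → R3 → ℝ :=
  dirs.foldr (dq h) W

/-- Conclusion of Thm 5 pp. 5–6 in the Heywood setting (t̂ = T₀/2, `F = F_H` read as `0`, data
`Υ_H(T₀/2)`): «|D_{h eᵢ}(V)| is bounded independently of λ and h, when 0 < λ < 1/4 and 0 < h < T₀/4» —
one constant for all `λ`, `h`, all three space directions, all 13 components, every `vn`-solution with the
data (continuity clauses of Thm 5 are not retyped). [cite: Smith2006, Thm 5 p.6 l.544–556] -/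
def Thm5Conclusion (vn : PViscosityNotion) (T₀ : ℝ) (u : ℝ → R3 → R3) (p : ℝ → R3 → ℝ) : Prop :=
  ∃ C : ℝ, ∀ lam : ℝ, 0 < lam → lam < 1 / 4 → ∀ h : ℝ, 0 < h → h < T₀ / 4 →
    ∀ V : AuxField, vn.IsSol lam AuxForce.zero (Ici (T₀ / 2)) V → V.slice (T₀ / 2) = heywoodData T₀ u p →
      ∀ k : Fin 3, (V.map (dq h (some k))).BoundedBy C (Ici (T₀ / 2))

/-- **Step 6 — Theorem 5** (pp. 5–6, l. 386–556): the first spatial difference quotients of the solution of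
Thm 3 (t̂ = T₀/2, data Υ_H(T₀/2), F = F_H) are bounded independently of λ and h. Printed proof: the
`D_{heᵢ}` Cauchy problem (15)–(18) is a λ-system of the same type with «merely continuous and bounded»
inhomogeneity (Remark 4 modifies [Sm3]'s `L_ω`), solved and bounded «by the same arguments as used in the
proof of Theorems 2, 3 and 4» (l. 530–535), then identified with `D_{heᵢ}(V)` by uniqueness (l. 537–541) —
so it inherits Steps 2–4's dependence on the comparison principle. Typist's flag: suspicious.
[cite: Smith2006, Thm 5 pp.5–6] -/
def Theorem5SpaceDQ (vn : PViscosityNotion) : Prop :=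
  ∀ (u₀ : R3 → R3) (T₀ : ℝ) (u : ℝ → R3 → R3) (p : ℝ → R3 → ℝ),
    IsSmithDatum u₀ → IsHeywoodTriple T₀ 0 u₀ u p → Thm5Conclusion vn T₀ u p

/-- Conclusion of Thm 6 + Cor 1 pp. 7–8 in the Heywood setting: the first (forward) time difference
quotient `D_{h e₀}(V)` of every `vn`-solution with the data is bounded independently of `λ ∈ (0,1/4)` and
`h ∈ (0, T₀/4)`, all 13 components (Cor 1: in particular all first quotients of `Υᵢⱼ`).
[cite: Smith2006, Thm 6 p.7 l.638–651 and Cor 1 pp.7–8] -/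
def Thm6Conclusion (vn : PViscosityNotion) (T₀ : ℝ) (u : ℝ → R3 → R3) (p : ℝ → R3 → ℝ) : Prop :=
  ∃ C : ℝ, ∀ lam : ℝ, 0 < lam → lam < 1 / 4 → ∀ h : ℝ, 0 < h → h < T₀ / 4 →
    ∀ V : AuxField, vn.IsSol lam AuxForce.zero (Ici (T₀ / 2)) V → V.slice (T₀ / 2) = heywoodData T₀ u p →
      (V.map (dq h none)).BoundedBy C (Ici (T₀ / 2))

/-- **Step 7 — Theorem 6 and Corollary 1** (pp. 6–8, l. 558–669): the first time difference quotient of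
the solution of Thm 3 is bounded independently of λ and h («By essentially the same arguement as used to
prove Theorem 5», l. 635–636). The printed DATA sentence of the `D_{he₀}` Cauchy problem (l. 599–609) is a
typing fork recorded in the module docstring, not a conjunct here. Typist's flag: suspicious.
[cite: Smith2006, Thm 6 and Cor 1 pp.6–8] -/
def Theorem6TimeDQ (vn : PViscosityNotion) : Prop :=
  ∀ (u₀ : R3 → R3) (T₀ : ℝ) (u : ℝ → R3 → R3) (p : ℝ → R3 → ℝ),
    IsSmithDatum u₀ → IsHeywoodTriple T₀ 0 u₀ u p → Thm6Conclusion vn T₀ u p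

/-- Conclusion of Thm 7 p. 8 in the Heywood setting: for EACH order `m ≥ 1` one constant `C_m` («these
bounds are different for each order of difference quotient, but they depend only on the initial data at
t̂ = T₀/2, and on F_H», Remark 8) bounding every iterated/mixed forward difference quotient of order `m` of
every `vn`-solution with the data, uniformly in `λ ∈ (0,1/4)`, `h ∈ (0,T₀/4)`.
[cite: Smith2006, Thm 7 p.8 l.676–686 and Remark 8] -/
def Thm7Conclusion (vn : PViscosityNotion) (T₀ : ℝ) (u : ℝ → R3 → R3) (p : ℝ → R3 → ℝ) : Prop :=
  ∀ m : ℕ, 1 ≤ m → ∃ C : ℝ, ∀ lam : ℝ, 0 < lam → lam < 1 / 4 → ∀ h : ℝ, 0 < h → h < T₀ / 4 →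
    ∀ V : AuxField, vn.IsSol lam AuxForce.zero (Ici (T₀ / 2)) V → V.slice (T₀ / 2) = heywoodData T₀ u p →
      ∀ dirs : List (Option (Fin 3)), dirs.length = m → (V.map (dqIter h dirs)).BoundedBy C (Ici (T₀ / 2))

/-- **Step 8 — Theorem 7** (p. 8, l. 671–709): «all the difference quotients of V of all orders in space
and time (including the mixed orders) are continuous and have bounded pointwise norms independently of λ and
h». One-sentence proof: «By direct elementary calculation and induction of the arguments in the proofs of
Theorems 5, 6 and Corollary 1» (l. 673–674), «using inductive pointwise norm bounds similar to those of
Corollary 1 at each inductive step» (Remark 9). Typist's flag: suspicious (the induction must close sup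
bounds for the quadratic `vₖ∂ₖvᵢ` terms at every order; referee E4). [cite: Smith2006, Thm 7 p.8] -/
def Theorem7AllDQ (vn : PViscosityNotion) : Prop :=
  ∀ (u₀ : R3 → R3) (T₀ : ℝ) (u : ℝ → R3 → R3) (p : ℝ → R3 → ℝ),
    IsSmithDatum u₀ → IsHeywoodTriple T₀ 0 u₀ u p → Thm7Conclusion vn T₀ u p

/-! ### Steps 9–11 — Theorem 8 (pp. 8–9): the limit, the matching, the integral condition -/

/-- All space-time derivatives of `w` (within the time set `Sw`) and of `u` (within `Su`) agree at time `τ`: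
«the derivatives in time and space (including the zeroth order derivative) of this solution 𝐕 match (at
t̂ = T₀/2) the corresponding derivatives of the Heywood local solution» (p. 9 l. 763–766).
[cite: Smith2006, Thm 8 proof p.9 l.763–766] -/
def JetsMatchAt {X : Type} [NormedAddCommGroup X] [NormedSpace ℝ X] (τ : ℝ) (Sw Su : Set ℝ)
    (w u : ℝ → R3 → X) : Prop :=
  ∀ (n : ℕ) (x : R3),
    iteratedFDerivWithin ℝ n (uncurry w) (Sw ×ˢ univ) (τ, x) =
      iteratedFDerivWithin ℝ n (uncurry u) (Su ×ˢ univ) (τ, x)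

/-- **Step 9 — Theorem 8, the limit** (proof pp. 8–9, l. 724–767). In the Heywood setting: IF for every
`0 < λ < 1/4` the λ-system (F read as `0`) has a continuous `vn`-solution `V_λ` on `[T₀/2, ∞)` with data
`Υ_H(T₀/2)` and C¹ velocity slots (Thm 3), the order-zero bounds of Thm 4 hold, and all difference quotients
of all orders are bounded uniformly in λ, h (Thm 7), THEN — «in a standard fashion, from the continuity and
bounds (on compact sets forming an exhausting sequence …), Arzela-Ascoli's theorem, and a diagonal
argument», a subsequence `λₙ ↓ 0`, `hₙ ↓ 0` converges to `C^∞` limits; «by the uniqueness theorem for the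
Cauchy problem for P-Viscosity solutions … these limit functions are equal to the appropriate difference
quotients of 𝐕»; «𝐕 is C^∞, and is a classical solution of eqs (1) (2) with υ = 1 on [T₀/2, ∞) × ℝ³» —
there is a smooth Navier–Stokes solution `(w, q)` (υ = 1, f = 0) on `[T₀/2, ∞) × ℝ³` whose jets at `T₀/2`
match those of `(u_H, p_H)` (l. 763–766) and whose velocity keeps the λ-uniform sup bound and spatial decay
of Thm 4 («the bounds of Theorems 3,4, which were independent of λ, h», l. 775–777). Typist's flag:
suspicious at the identification/matching clauses (time-derivative matching at `T₀/2` and the pressure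
slot are not argued; referee E5). [cite: Smith2006, Thm 8 proof pp.8–9 l.724–767] -/
def Theorem8Limit (vn : PViscosityNotion) : Prop :=
  ∀ (u₀ : R3 → R3) (T₀ : ℝ) (u : ℝ → R3 → R3) (p : ℝ → R3 → ℝ),
    IsSmithDatum u₀ → IsHeywoodTriple T₀ 0 u₀ u p →
    (∀ lam : ℝ, 0 < lam → lam < 1 / 4 →
      ∃ V : AuxField, vn.IsSol lam AuxForce.zero (Ici (T₀ / 2)) V ∧
        V.slice (T₀ / 2) = heywoodData T₀ u p ∧ ∀ i, IsCkOnSlab 1 (Ici (T₀ / 2)) fun t x => V.v t x i) →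
    Thm4Conclusion vn AuxForce.zero (Ici (T₀ / 2)) (T₀ / 2) (heywoodData T₀ u p) →
    Thm7Conclusion vn T₀ u p →
      ∃ (w : ℝ → R3 → R3) (q : ℝ → R3 → ℝ),
        IsClassicalNSSolutionOn (Ici (T₀ / 2)) 1 0 w q ∧
        JetsMatchAt (T₀ / 2) (Ici (T₀ / 2)) (Ico 0 T₀) w u ∧
        JetsMatchAt (T₀ / 2) (Ici (T₀ / 2)) (Ico 0 T₀) q p ∧
        (∃ C : ℝ, ∀ t ∈ Ici (T₀ / 2), ∀ x, ‖w t x‖ ≤ C) ∧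
        ∀ t ∈ Ici (T₀ / 2), ∀ ε : ℝ, 0 < ε → ∃ R : ℝ, ∀ x : R3, R ≤ ‖x‖ → ‖w t x‖ ≤ ε

/-- The matched field of p. 9 l. 768–771: Heywood's solution before `τ = T₀/2`, the limit from `τ` on
(«Here, uⁱ := vⁱ when t ≥ T₀/2»). [cite: Smith2006, Thm 8 proof p.9 l.768–771] -/
def timeGlue {X : Type} (τ : ℝ) (a b : ℝ → R3 → X) : ℝ → R3 → X :=
  fun t => if t < τ then a t else b t

/-- **Step 10 — the gluing** (p. 9 l. 760–771, implicit): a smooth solution `(u, p)` on `[0, T₀) × ℝ³` and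
a smooth solution `(w, q)` on `[T₀/2, ∞) × ℝ³` of the same system (υ = 1, f = 0) whose space-time jets
agree at `T₀/2` patch to a smooth solution on `[0, ∞) × ℝ³` («We call denote this matched solution of the
Navier-Stokes equations … on [0,∞) × ℝ³ by u,p»). Elementary real analysis (one-sided jets agree ⇒ `C^∞`
across `t = T₀/2`); not proved here. Typist's flag: true (routine). [cite: Smith2006, Thm 8 proof p.9 l.760–771] -/
def Theorem8Gluing : Prop :=
  ∀ (T₀ : ℝ), 0 < T₀ → ∀ (u w : ℝ → R3 → R3) (p q : ℝ → R3 → ℝ),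
    IsClassicalNSSolutionOn (Ico 0 T₀) 1 0 u p → IsClassicalNSSolutionOn (Ici (T₀ / 2)) 1 0 w q →
    JetsMatchAt (T₀ / 2) (Ici (T₀ / 2)) (Ico 0 T₀) w u → JetsMatchAt (T₀ / 2) (Ici (T₀ / 2)) (Ico 0 T₀) q p →
      IsClassicalNSSolutionOn (Ici 0) 1 0 (timeGlue (T₀ / 2) u w) (timeGlue (T₀ / 2) p q)

/-- **Step 11 — the integral condition** (p. 9 l. 772–779): «When 0 ≤ [t <] T₀/2 the condition
∫|u(t,x)| dx ≤ C follows from Theorem 1, i.e. [H]. When t > T₀/2 this integral condition follows from the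
bounds of Theorems 3,4, which were independent of λ, h … Hence, the integral condition is preserved at the
limit» — typed as the inference the print makes, for the matched smooth global solution with datum `u⁰`:
square-integrable slices on `[0, T₀/2)` (Thm 1 (5c)) and a sup-bounded, spatially decaying velocity on
`[T₀/2, ∞)` (Thm 4 via Thm 8) give bounded energy (7). Typist's flag: suspicious as an inference (sup
bound + pointwise decay do not give an `L²` bound), plausible for the object. [cite: Smith2006, Thm 8 proof p.9 l.772–779] -/
def Theorem8Energy : Prop :=
  ∀ (u₀ : R3 → R3), IsSmithDatum u₀ → ∀ (T₀ : ℝ), 0 < T₀ →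
    ∀ (U : ℝ → R3 → R3) (Q : ℝ → R3 → ℝ), IsClassicalNSSolutionOn (Ici 0) 1 0 U Q → U 0 = u₀ →
      (∀ t ∈ Ico 0 (T₀ / 2), ∀ n : ℕ, ∫⁻ x, ‖iteratedFDeriv ℝ n (U t) x‖ₑ ^ 2 < ⊤) →
      (∃ C : ℝ, ∀ t ∈ Ici (T₀ / 2), ∀ x, ‖U t x‖ ≤ C) →
      (∀ t ∈ Ici (T₀ / 2), ∀ ε : ℝ, 0 < ε → ∃ R : ℝ, ∀ x : R3, R ≤ ‖x‖ → ‖U t x‖ ≤ ε) →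
        HasBoundedEnergy U

/-! ### The claimed theorem (Theorem 8 p. 8 + p. 9 l. 779–781 + Corollary 2 p. 9) -/

/-- The paper's setting as a spec of the `ClayVariants` schema: data «u⁰ ∈ H^{m,2}(ℝ³) ∩ C^∞(ℝ³) ∀ m»
(Thm 1 p. 2; on top of smooth + divergence free), forces of Thm 1's class (5) (only `f = 0` is used by
Thm 8), side condition = Clay (7) (the printed «∫_ℝ |u(t,x)| dx ≤ C ∀ t ≥ 0», p. 8 l. 720–721, read as
(7); typing fork recorded). [cite: Smith2006, Thm 1 p.2 and Thm 8 p.8] -/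
def smithSpec : ClayVariants.ClaySpec where
  data := fun u₀ => ∀ n : ℕ, ∫⁻ x, ‖iteratedFDeriv ℝ n u₀ x‖ₑ ^ 2 < ⊤
  force := HasRapidSpaceTimeDecay
  admissible := fun u _ => HasBoundedEnergy u

/-- **The claimed theorem** (Thm 8 p. 8 l. 713–722 with p. 9 l. 779–781 «we can replace υ = 1 by any
positive υ», and Cor 2 p. 9 «Statement (A) page 2 of [F] is true»): for every `υ > 0` and every smooth
divergence-free `u⁰` with all derivatives in `L²`, the unforced Navier–Stokes system has a solution `(u, p)`
smooth on `ℝ³ × [0,∞)` with `u(0) = u⁰` and bounded energy. [cite: Smith2006, Thm 8 p.8 and Cor 2 p.9] -/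
def ClaimedTheorem : Prop :=
  smithSpec.Regularity

/-! ### Kernel relations -/

/-- `ComparisonAux vn` for any notion yields the classical, notion-free `ComparisonAuxClassical` (classical
sub/supersolutions are `vn`-ones by the two structure fields): a countermodel to the latter refutes the
former for EVERY `vn`. [cite: Smith2006PerronGeneral, Remark p.11 l.1103–1106] -/
theorem comparisonAuxClassical_of (vn : PViscosityNotion) (h : ComparisonAux vn) :
    ComparisonAuxClassical := by
  intro lam tHat S W₀ F h0 h1 ht hS hW hF V₁ V₂ h1c h1b h1h h1r h2c h2b h2h h2r h1d h2d
  exact h lam tHat S W₀ F h0 h1 ht hS hW hF V₁ V₂ (vn.super_of_classical lam F S V₁ h1c h1b h1h h1r)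
    (vn.sub_of_classical lam F S V₂ h2c h2b h2h h2r) h1d h2d

/-- **Uniqueness from comparison** — the printed proof of [Sm3] Thm 6 pp. 10–11 («u₁, u₂ are both viscosity
super and subsolutions with the same Cauchy data. Thus, Theorem 1 implies that u₁ ≥ u₂ and u₂ ≥ u₁»),
kernel-checked: `ComparisonAux vn → Theorem3Unique vn`. [cite: Smith2006PerronGeneral, Thm 6 proof p.11] -/
theorem theorem3Unique_of_comparison (vn : PViscosityNotion) (h : ComparisonAux vn) :
    Theorem3Unique vn := by
  intro lam tHat S W₀ F h0 h1 ht hS hW hF V V' hV hVd hV' hV'd t htS x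
  have h₁ := h lam tHat S W₀ F h0 h1 ht hS hW hF V V' hV.2.2 hV'.2.1 hVd hV'd t htS x
  have h₂ := h lam tHat S W₀ F h0 h1 ht hS hW hF V' V hV'.2.2 hV.2.1 hV'd hVd t htS x
  exact ⟨le_antisymm h₂.1 h₁.1, fun i => le_antisymm (h₂.2.1 i) (h₁.2.1 i),
    fun i j => le_antisymm (h₂.2.2 i j) (h₁.2.2 i j)⟩

/-- Squeeze for the sup bound: `a ≤ w ≤ b`, `|a| ≤ M`, `|b| ≤ M` ⇒ `|w| ≤ M`. [folklore] -/
private theorem abs_le_of_between {a w b M : ℝ} (hab : a ≤ w) (hwb : w ≤ b) (ha : |a| ≤ M)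
    (hb : |b| ≤ M) : |w| ≤ M :=
  abs_le.mpr ⟨le_trans (abs_le.mp ha).1 hab, le_trans hwb (abs_le.mp hb).2⟩

/-- Squeeze for the decay: a scalar component between two decaying components decays. [folklore] -/
private theorem decaysOnSlab_of_between {S : Set ℝ} {U W V : ℝ → R3 → ℝ}
    (hle₁ : ∀ t ∈ S, ∀ x, U t x ≤ W t x) (hle₂ : ∀ t ∈ S, ∀ x, W t x ≤ V t x)
    (hU : DecaysOnSlab S U) (hV : DecaysOnSlab S V) : DecaysOnSlab S W := by
  intro t ht ε hε
  obtain ⟨R₁, hR₁⟩ := hU t ht ε hε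
  obtain ⟨R₂, hR₂⟩ := hV t ht ε hε
  refine ⟨max R₁ R₂, fun x hx => ?_⟩
  have h1 := hR₁ x (le_trans (le_max_left _ _) hx)
  have h2 := hR₂ x (le_trans (le_max_right _ _) hx)
  exact abs_le.mpr ⟨le_trans (abs_le.mp h1).1 (hle₁ t ht x), le_trans (hle₂ t ht x) (abs_le.mp h2).2⟩

/-- **The printed proof of Theorem 4** (p. 4 l. 364–367: «the bounds above are given by the bounds on V^#
and U^# constructed in Theorem 2. This follows by applying (for each λ) the comparison principle given as
Theorem 4 of [SM3]»), kernel-checked from the CHARITABLE Step 2′: the barriers (for each λ) and the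
intermediate `ComparisonAux vn` give Step 4 (the solution lies between `U_#` and `V^#`, which are bounded
by the λ-independent `M` and decay). Under MAP-SCHEMA §1b a refutation of the intermediate alone makes the
break «unfilled gap at `Theorem4Bounds`». [cite: Smith2006, Thm 4 proof p.4 l.364–367] -/
theorem theorem4Bounds_of_barriers'_comparison (vn : PViscosityNotion) (h2 : Theorem2Barriers')
    (hc : ComparisonAux vn) : Theorem4Bounds vn := by
  intro tHat S W₀ F ht hS hW hF
  obtain ⟨M, hM⟩ := h2 tHat S W₀ F ht hS hW hF
  refine ⟨M, fun lam h0 h1 V hsol hVd => ?_⟩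
  obtain ⟨Vs, Us, ⟨hVs2, hVs22, hVsd, hVsM, hVsdec⟩, ⟨hUs2, hUs22, hUsd, hUsM, hUsdec⟩, hVsign, hUsign⟩ :=
    hM lam h0 h1
  have hsup : vn.IsSuper lam F S Vs := vn.super_of_classical lam F S Vs hVs2 ⟨M, hVsM⟩ hVs22 hVsign
  have hsub : vn.IsSub lam F S Us := vn.sub_of_classical lam F S Us hUs2 ⟨M, hUsM⟩ hUs22 hUsign
  have hup : V.Below S Vs := hc lam tHat S W₀ F h0 h1 ht hS hW hF Vs V hsup hsol.2.1 hVsd hVd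
  have hdn : Us.Below S V := hc lam tHat S W₀ F h0 h1 ht hS hW hF V Us hsol.2.2 hsub hVd hUsd
  refine ⟨fun t htS x => ⟨fun i => ?_, fun i j => ?_⟩, fun i => ?_, fun i j => ?_⟩
  · exact abs_le_of_between ((hdn t htS x).2.1 i) ((hup t htS x).2.1 i) (hUsM.2.1 i t htS x)
      (hVsM.2.1 i t htS x)
  · exact abs_le_of_between ((hdn t htS x).2.2 i j) ((hup t htS x).2.2 i j) (hUsM.2.2 i j t htS x)
      (hVsM.2.2 i j t htS x)
  · exact decaysOnSlab_of_between (fun t htS x => (hdn t htS x).2.1 i)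
      (fun t htS x => (hup t htS x).2.1 i) (hUsdec.2.1 i) (hVsdec.2.1 i)
  · exact decaysOnSlab_of_between (fun t htS x => (hdn t htS x).2.2 i j)
      (fun t htS x => (hup t htS x).2.2 i j) (hUsdec.2.2 i j) (hVsdec.2.2 i j)

/-- The same from the LITERAL Step 2 (which implies Step 2′). [cite: Smith2006, Thm 4 proof p.4 l.364–367] -/
theorem theorem4Bounds_of_barriers_comparison (vn : PViscosityNotion) (h2 : Theorem2Barriers)
    (hc : ComparisonAux vn) : Theorem4Bounds vn :=
  theorem4Bounds_of_barriers'_comparison vn (theorem2Barriers'_of_literal h2) hc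

/-- The force the chain uses, `F ≡ 0`, is admissible on any time set (continuous, bounded, decaying).
[cite: Smith2006, Thm 2 p.3 l.273–274] -/
theorem AuxForce.isAdmissible_zero (S : Set ℝ) : AuxForce.zero.IsAdmissible S := by
  refine ⟨⟨?_, fun i => ?_⟩, ⟨0, fun t _ x => ?_, fun i t _ x => ?_⟩,
    fun ε hε => ⟨0, fun t _ x _ => ⟨?_, fun i => ?_⟩⟩⟩
  · exact continuousOn_const
  · exact continuousOn_const
  · simp [AuxForce.zero]
  · simp [AuxForce.zero]
  · simpa [AuxForce.zero] using hε.le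
  · simpa [AuxForce.zero] using hε.le

/-- A CLASSICAL solution of (6) — C² on the slab, bounded, in `H^{2,2}`, residual identically zero — is
a `vn`-solution for every notion `vn` (v4 p. 9 l. 747–748 «a classical solution—and hence a-fortiori a
P-solution»; [Sm3] Remark p. 11 l. 1103–1106): the kernel form of the licence by which classical objects
enter the universally quantified steps (e.g. an explicit classical solution of (6) is THE solution of
Thm 3 by `Theorem3Unique`). [cite: Smith2006, Thm 8 proof p.9 l.747–748] -/
theorem PViscosityNotion.isSol_of_classical (vn : PViscosityNotion) {lam : ℝ} {F : AuxForce}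
    {S : Set ℝ} {V : AuxField} (hC : V.IsCk 2 S) (hB : V.IsBounded S) (hH : V.IsH22 S)
    (h0 : ∀ t ∈ S, ∀ x, auxResidualP lam F S V t x = 0 ∧ (∀ i, auxResidualV F S V t x i = 0) ∧
      ∀ i j, auxResidualΥ lam S V t x i j = 0) :
    vn.IsSol lam F S V := by
  have h02 : (0 : WithTop ℕ∞) ≤ 2 := by norm_num
  refine ⟨⟨hC.1.of_le h02, fun i => (hC.2.1 i).of_le h02, fun i j => (hC.2.2 i j).of_le h02⟩,
    vn.sub_of_classical lam F S V hC hB hH ?_, vn.super_of_classical lam F S V hC hB hH ?_⟩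
  · intro t ht x
    obtain ⟨hp, hv, hY⟩ := h0 t ht x
    exact ⟨hp.le, fun i => (hv i).le, fun i j => (hY i j).le⟩
  · intro t ht x
    obtain ⟨hp, hv, hY⟩ := h0 t ht x
    exact ⟨hp.ge, fun i => (hv i).ge, fun i j => (hY i j).ge⟩

/-- `[t̂, ∞)` is one of the printed time domains (T = ∞). [cite: Smith2006, Thm 3 p.4 («T ≤ ∞»)] -/
theorem isTimeSlab_Ici (tHat : ℝ) : IsTimeSlab tHat (Ici tHat) :=
  Or.inr rfl

/-- Step 2′ and Step 5 give Thm 2 at the instance the chain consumes (`t̂ = T₀/2`, `[T₀/2, ∞)`,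
`W₀ = Υ_H(T₀/2)`, `F = 0`). [cite: Smith2006, Thm 2 pp.3–4 with Remark 3 p.5] -/
theorem theorem2BarriersHeywood_of (h2 : Theorem2Barriers') (h5 : Remark3Data) : Theorem2BarriersHeywood := by
  intro u₀ T₀ u p hd hH
  have hhalf : 0 ≤ T₀ / 2 := by have := hH.pos; positivity
  exact h2 (T₀ / 2) (Ici (T₀ / 2)) (heywoodData T₀ u p) AuxForce.zero hhalf (isTimeSlab_Ici _)
    (h5 u₀ T₀ u p hd hH) (AuxForce.isAdmissible_zero _)

/-- The data slot of `smithSpec` is closed under constant multiples (for the υ-scaling of (3)–(4) p. 1).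
[cite: Smith2006, eqs. (3)–(4) p.1] -/
theorem smithSpec_data_smul (c : ℝ) (_hc : 0 < c) (u₀ : R3 → R3) (hu₀ : ContDiff ℝ ∞ u₀)
    (hd : smithSpec.data u₀) : smithSpec.data (fun x => c • u₀ x) := by
  intro n
  have hn : ∀ x, ContDiffAt ℝ n u₀ x := fun x => (hu₀.of_le (by exact_mod_cast le_top)).contDiffAt
  have heq : ∀ x, iteratedFDeriv ℝ n (fun x => c • u₀ x) x = c • iteratedFDeriv ℝ n u₀ x := fun x =>
    iteratedFDeriv_const_smul_apply' (hn x)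
  have h2 : ∫⁻ x, ‖iteratedFDeriv ℝ n (fun x => c • u₀ x) x‖ₑ ^ 2 =
      ‖c‖ₑ ^ 2 * ∫⁻ x, ‖iteratedFDeriv ℝ n u₀ x‖ₑ ^ 2 := by
    rw [← lintegral_const_mul' _ _ (by simp)]
    refine lintegral_congr fun x => ?_
    rw [heq x, enorm_smul, mul_pow]
  change ∫⁻ x, ‖iteratedFDeriv ℝ n (fun x => c • u₀ x) x‖ₑ ^ 2 < ⊤
  rw [h2]
  exact ENNReal.mul_lt_top (by simp) (hd n)

/-- The side condition of `smithSpec` (= Clay (7)) is dilation invariant (tree lemma).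
[cite: Smith2006, eqs. (3)–(4) p.1] -/
theorem smithSpec_admissible_timeRescale (a : ℝ) (ha : 0 < a) (v : ℝ → R3 → R3) (q : ℝ → R3 → ℝ)
    (h : smithSpec.admissible v q) :
    smithSpec.admissible (timeRescale a a v) (timeRescale a (a ^ 2) q) :=
  ClayVariants.hasBoundedEnergy_timeRescale h ha

/-- **COMPOSITION** (the paper's chain, pp. 2–9, under the reading `F₁ = 0`; hypotheses = Steps 1–11 in
the ORDERED STEP INDEX, for an arbitrary solution notion `vn`; Steps 2, 6, 7 are on the printed path but
enter the headline only through Steps 4, 8, 9). At `υ = 1`: Thm 1 gives `(T₀, u_H, p_H)`; Remark 3 makes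
`Υ_H(T₀/2)` admissible data; Thm 3 gives the λ-solutions on `[T₀/2, ∞)`, Thm 4 and Thm 7 their λ, h-uniform
bounds; Thm 8 extracts the smooth limit solution matching Heywood's jets at `T₀/2`; gluing gives a smooth
solution on `[0, ∞)` with datum `u⁰`; the integral condition gives (7); the tree's
`isNavierStokesSolution_and_smooth_iff` turns the classical solution into the Clay-form one, and «replace
υ = 1 by any positive υ» (p. 9 l. 779–781, by (3)–(4)) is the tree's `ClaySpec.regularityAt_iff_regularity`.
Pure logic over the steps. [cite: Smith2006, Thm 8 proof pp.8–9 and Cor 2 p.9] -/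
theorem claim_of_steps (vn : PViscosityNotion)
    (h1 : Theorem1Heywood) (_h2 : Theorem2Barriers) (h3 : Theorem3 vn) (h4 : Theorem4Bounds vn)
    (h5 : Remark3Data) (_h6 : Theorem5SpaceDQ vn) (_h7 : Theorem6TimeDQ vn) (h8 : Theorem7AllDQ vn)
    (h9 : Theorem8Limit vn) (h10 : Theorem8Gluing) (h11 : Theorem8Energy) : ClaimedTheorem := by
  refine (ClayVariants.ClaySpec.regularityAt_iff_regularity (S := smithSpec) one_pos smithSpec_data_smul
    smithSpec_admissible_timeRescale).mp ?_
  intro u₀ hu₀ hdiv hdat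
  have hdatum : IsSmithDatum u₀ := ⟨hu₀, hdiv, hdat⟩
  obtain ⟨T₀, u, p, hH⟩ := h1 u₀ hdatum 0 ClayVariants.isSmoothOnHalfSpace_zero
    ClayVariants.hasRapidSpaceTimeDecay_zero
  have hT₀ : 0 < T₀ := hH.pos
  have hhalf : 0 ≤ T₀ / 2 := by positivity
  have hW₀ : (heywoodData T₀ u p).IsAdmissible := h5 u₀ T₀ u p hdatum hH
  have hF : AuxForce.zero.IsAdmissible (Ici (T₀ / 2)) := AuxForce.isAdmissible_zero _
  have hex : ∀ lam : ℝ, 0 < lam → lam < 1 / 4 →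
      ∃ V : AuxField, vn.IsSol lam AuxForce.zero (Ici (T₀ / 2)) V ∧
        V.slice (T₀ / 2) = heywoodData T₀ u p ∧ ∀ i, IsCkOnSlab 1 (Ici (T₀ / 2)) fun t x => V.v t x i :=
    fun lam hl0 hl1 => h3.1 lam (T₀ / 2) (Ici (T₀ / 2)) (heywoodData T₀ u p) AuxForce.zero hl0 hl1 hhalf
      (isTimeSlab_Ici _) hW₀ hF
  have hb4 : Thm4Conclusion vn AuxForce.zero (Ici (T₀ / 2)) (T₀ / 2) (heywoodData T₀ u p) :=
    h4 (T₀ / 2) (Ici (T₀ / 2)) (heywoodData T₀ u p) AuxForce.zero hhalf (isTimeSlab_Ici _) hW₀ hF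
  have hb7 : Thm7Conclusion vn T₀ u p := h8 u₀ T₀ u p hdatum hH
  obtain ⟨w, q, hwq, hju, hjq, hbd, hdec⟩ := h9 u₀ T₀ u p hdatum hH hex hb4 hb7
  have hglue := h10 T₀ hT₀ u w p q hH.sol hwq hju hjq
  set U := timeGlue (T₀ / 2) u w with hU
  set Q := timeGlue (T₀ / 2) p q with hQ
  have hUlt : ∀ t, t < T₀ / 2 → U t = u t := fun t ht => by simp [hU, timeGlue, ht]
  have hUge : ∀ t, T₀ / 2 ≤ t → U t = w t := fun t ht => by simp [hU, timeGlue, not_lt.mpr ht]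
  have hU0 : U 0 = u₀ := by
    rw [hUlt 0 (by positivity)]
    exact hH.initial
  have hslices : ∀ t ∈ Ico 0 (T₀ / 2), ∀ n : ℕ, ∫⁻ x, ‖iteratedFDeriv ℝ n (U t) x‖ₑ ^ 2 < ⊤ := by
    intro t ht n
    have htI : t ∈ Ico 0 T₀ := ⟨ht.1, lt_trans ht.2 (by linarith)⟩
    have h5c := hH.sqInt_u t htI 0 n
    rw [hUlt t ht.2]
    simpa [iteratedDerivWithin_zero] using h5c
  have hbdU : ∃ C : ℝ, ∀ t ∈ Ici (T₀ / 2), ∀ x, ‖U t x‖ ≤ C := by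
    obtain ⟨C, hC⟩ := hbd
    exact ⟨C, fun t ht x => by rw [hUge t ht]; exact hC t ht x⟩
  have hdecU : ∀ t ∈ Ici (T₀ / 2), ∀ ε : ℝ, 0 < ε → ∃ R : ℝ, ∀ x : R3, R ≤ ‖x‖ → ‖U t x‖ ≤ ε := by
    intro t ht ε hε
    obtain ⟨R, hR⟩ := hdec t ht ε hε
    exact ⟨R, fun x hx => by rw [hUge t ht]; exact hR x hx⟩
  have hE : HasBoundedEnergy U := h11 u₀ hdatum T₀ hT₀ U Q hglue hU0 hslices hbdU hdecU
  obtain ⟨hns, hUs, hQs⟩ := isNavierStokesSolution_and_smooth_iff.mpr ⟨hglue, hU0⟩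
  exact ⟨U, Q, hUs, hQs, hns, hE⟩

/-- **Clay link (TYPING-HYGIENE §10 (a)): the claimed theorem implies Clay (A)** in the reference schema
— `smithSpec` admits MORE data than `clayR3` (Clay (4) data have all derivatives in `L²`:
`HasRapidSpatialDecay.lintegral_enorm_iteratedFDeriv_sq_lt_top`) and asks the SAME side condition (7).
Summit-side `clayR3.Regularity ↔ NavierStokesRegularity` is `Iff.rfl`. Hence no «wrong problem» axis for
C06 (agreeing with referee R#0). [cite: Smith2006, Cor 2 p.9] [cite: FeffermanClay2006, (A) p.2] -/
theorem clay_of_claimed (h : ClaimedTheorem) : ClayVariants.clayR3.Regularity :=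
  ClayVariants.ClaySpec.Regularity.mono (S := smithSpec) (T := ClayVariants.clayR3)
    (fun _ hd n => HasRapidSpatialDecay.lintegral_enorm_iteratedFDeriv_sq_lt_top hd n)
    (fun _ _ ha => ha) h

/-! ### D-0026 in-file discharge of Step 5 (`Remark3Data`) — ns-claims-typist-3 g5, 2026-08-27 (APPEND-ONLY;
no statement, locator, class or token of row C06 #14 is touched) -/

/-- Composition with a continuous linear map of norm `≤ 1` does not increase the `L²` size of the
`n`-th derivative: `∫‖Dⁿ(L ∘ g)‖² ≤ ∫‖Dⁿg‖²` for smooth `g`. [folklore] -/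
private theorem lintegral_iteratedFDeriv_comp_clm_le {F G : Type*} [NormedAddCommGroup F]
    [NormedSpace ℝ F] [NormedAddCommGroup G] [NormedSpace ℝ G] (L : F →L[ℝ] G) (hL : ‖L‖ ≤ 1)
    {g : R3 → F} (hg : ContDiff ℝ ∞ g) (n : ℕ) :
    ∫⁻ x, ‖iteratedFDeriv ℝ n (fun y => L (g y)) x‖ₑ ^ 2 ≤ ∫⁻ x, ‖iteratedFDeriv ℝ n g x‖ₑ ^ 2 := by
  refine lintegral_mono fun x => ?_
  have h1 : ‖iteratedFDeriv ℝ n (fun y => L (g y)) x‖ ≤ ‖iteratedFDeriv ℝ n g x‖ := by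
    have h := L.norm_iteratedFDeriv_comp_left (f := g) (x := x) (n := n)
      (hg.contDiffAt (x := x)) (by exact_mod_cast le_top)
    have h' : ‖L‖ * ‖iteratedFDeriv ℝ n g x‖ ≤ 1 * ‖iteratedFDeriv ℝ n g x‖ :=
      mul_le_mul_of_nonneg_right hL (norm_nonneg _)
    rw [one_mul] at h'
    exact h.trans h'
  have h2 : ‖iteratedFDeriv ℝ n (fun y => L (g y)) x‖ₑ ≤ ‖iteratedFDeriv ℝ n g x‖ₑ := by
    rw [← ofReal_norm, ← ofReal_norm]
    exact ENNReal.ofReal_le_ofReal h1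
  gcongr

/-- **Step 5 (Remark 3 p.5) holds**: for every Heywood triple `(T₀, u, p)` from a Smith datum, the slice
data `Υ_H(T₀/2) = (p(T₀/2), u(T₀/2), ∇u(T₀/2))` are admissible for Thms 2–4 — every component is `C^∞`
with all derivatives in `L²(ℝ³)`, read off (5a)–(5c) at `t̄ = T₀/2 ∈ [0, T₀)` (`β = 0` in (5c); the
component and gradient slots by composition with continuous linear maps of norm `≤ 1` and the order shift
`‖Dⁿ(∇g)‖ = ‖Dⁿ⁺¹g‖`). The datum hypothesis is not used. [cite: Smith2006, Def 3 and Remark 3 p.5 l.381–385] -/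
theorem remark3Data_holds : Remark3Data := by
  intro u₀ T₀ u p _hd hH
  have hT₀ : 0 < T₀ := hH.pos
  set t : ℝ := T₀ / 2 with ht_def
  have ht : t ∈ Ico 0 T₀ := ⟨by positivity, by rw [ht_def]; linarith⟩
  have hu : ContDiff ℝ ∞ (u t) := hH.sol.contDiff_velocity ht
  have hp : ContDiff ℝ ∞ (p t) := hH.sol.contDiff_pressure ht
  -- (5c) at `β = 0`
  have hU : ∀ n : ℕ, ∫⁻ x, ‖iteratedFDeriv ℝ n (u t) x‖ₑ ^ 2 < ⊤ := fun n => by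
    have h := hH.sqInt_u t ht 0 n
    simpa only [iteratedDerivWithin_zero] using h
  have hP : ∀ n : ℕ, ∫⁻ x, ‖iteratedFDeriv ℝ n (p t) x‖ₑ ^ 2 < ⊤ := fun n => by
    have h := hH.sqInt_p t ht 0 n
    simpa only [iteratedDerivWithin_zero] using h
  -- the components `u(t)ᵢ = ⟪eᵢ, u(t)⟫`
  have hcomp : ∀ i : Fin 3, (fun x => u t x i) =
      fun x => innerSL ℝ (EuclideanSpace.single i (1 : ℝ)) (u t x) := by
    intro i; funext x
    rw [innerSL_apply_apply, EuclideanSpace.inner_single_left]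
    simp
  have hLi : ∀ i : Fin 3, ‖innerSL ℝ (EuclideanSpace.single i (1 : ℝ) : R3)‖ ≤ 1 := fun i => by
    rw [innerSL_apply_norm]
    simp
  have hui : ∀ i : Fin 3, ContDiff ℝ ∞ (fun x => u t x i) := fun i => by
    rw [hcomp i]; exact (innerSL ℝ _).contDiff.comp hu
  have hUi : ∀ (i : Fin 3) (n : ℕ), ∫⁻ x, ‖iteratedFDeriv ℝ n (fun x => u t x i) x‖ₑ ^ 2 < ⊤ := by
    intro i n
    rw [hcomp i]
    exact (lintegral_iteratedFDeriv_comp_clm_le _ (hLi i) hu n).trans_lt (hU n)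
  -- the gradient slots `∂ⱼ uᵢ(t) = (D uᵢ(t)) eⱼ`
  have hpd : ∀ i j : Fin 3, (fun x => pd (fun y => u t y i) j x) =
      fun x => (ContinuousLinearMap.apply ℝ ℝ (EuclideanSpace.single j (1 : ℝ) : R3))
        (fderiv ℝ (fun y => u t y i) x) := by
    intro i j; funext x; rfl
  have hAj : ∀ j : Fin 3,
      ‖(ContinuousLinearMap.apply ℝ ℝ (EuclideanSpace.single j (1 : ℝ) : R3))‖ ≤ 1 := fun j => by
    refine ContinuousLinearMap.opNorm_le_bound _ zero_le_one fun f => ?_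
    rw [ContinuousLinearMap.apply_apply, one_mul]
    calc ‖f (EuclideanSpace.single j (1 : ℝ))‖ ≤ ‖f‖ * ‖(EuclideanSpace.single j (1 : ℝ) : R3)‖ :=
          f.le_opNorm _
      _ = ‖f‖ := by simp
  have hfd : ∀ i : Fin 3, ContDiff ℝ ∞ (fderiv ℝ (fun y => u t y i)) := fun i =>
    (hui i).fderiv_right (by exact_mod_cast le_top)
  refine ⟨⟨hp, hP⟩, fun i => ⟨hui i, hUi i⟩, fun i j => ⟨?_, fun n => ?_⟩⟩
  · -- smoothness of `∂ⱼ uᵢ(t)`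
    show ContDiff ℝ ∞ (fun x => pd (fun y => u t y i) j x)
    rw [hpd i j]
    exact (ContinuousLinearMap.apply ℝ ℝ _).contDiff.comp (hfd i)
  · -- `∫‖Dⁿ ∂ⱼuᵢ‖² ≤ ∫‖Dⁿ(Duᵢ)‖² = ∫‖Dⁿ⁺¹uᵢ‖² < ∞`
    show ∫⁻ x, ‖iteratedFDeriv ℝ n (fun x => pd (fun y => u t y i) j x) x‖ₑ ^ 2 < ⊤
    rw [hpd i j]
    refine (lintegral_iteratedFDeriv_comp_clm_le _ (hAj j) (hfd i) n).trans_lt ?_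
    have heq : (fun x => ‖iteratedFDeriv ℝ n (fderiv ℝ (fun y => u t y i)) x‖ₑ ^ 2) =
        fun x => ‖iteratedFDeriv ℝ (n + 1) (fun y => u t y i) x‖ₑ ^ 2 := by
      funext x
      rw [← ofReal_norm, ← ofReal_norm, norm_iteratedFDeriv_fderiv]
    rw [heq]
    exact hUi i (n + 1)

/-! ### D-0026 in-file discharge of Step 10 (`Theorem8Gluing`) — ns-claims-typist-3 g5, 2026-08-27
(APPEND-ONLY + 1 import `Literature.Analysis.FluidPDE.ClassicalSolutionTimeGluing`; no statement,
locator or class of the record above is touched) -/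

/-- **Step 10 holds** (Thm 8 proof p. 9 l. 760–771, «the derivatives in time and space (including the
zeroth order derivative) … match (at t̂ = T₀/2) … We call denote this matched solution … on [0,∞) × ℝ³
by u, p»): two classical solutions of the system (υ = 1, f = 0) on `[0, T₀) × ℝ³` and `[T₀/2, ∞) × ℝ³`
whose space–time jets agree at `T₀/2` patch, by `timeGlue (T₀/2)`, to a classical solution on
`[0, ∞) × ℝ³` — the tree's `IsClassicalNSSolutionOn.glue_of_jetsMatch` (smoothness by pasting the
Taylor series of the two pieces on the closed slabs `[0, T₀/2] × ℝ³` and `[T₀/2, ∞) × ℝ³`; the momentum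
equation at `t ≥ T₀/2` through the one-sided derivative within `[T₀/2, ∞)`).
[cite: Smith2006, Thm 8 proof p.9 l.760–771] -/
theorem theorem8Gluing_holds : Theorem8Gluing := by
  intro T₀ hT₀ u w p q hu hw hj hjq
  exact hu.glue_of_jetsMatch (by positivity) (by linarith) hw hj hjq

end Literature.Claims.NS.Smith2006

end

-- WHAT THIS IS NOT: not a claim about NS regularity or blow-up; not a claim about any author beyond the
-- typed locator.
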